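import Mathlib
import Literature.NumberTheory.LFunctions.Zhang2022.SkeletonPartThree
import Literature.NumberTheory.LFunctions.Zhang2022.AppendixB
import Literature.NumberTheory.LFunctions.Zhang2022.TypedSection15A
import Literature.NumberTheory.LFunctions.Zhang2022.TypedSection15B
import Literature.NumberTheory.LFunctions.Zhang2022.TypedAppendixB
import HarnessLib

/-!
# Zhang (2022), TYPED §15 part C: from Lemma 15.1 to (15.24) (pp. 86–88, tex L4273–L4396)

Topic `Literature/NumberTheory/LFunctions/Zhang2022` (Landau–Siegel audit tree; verdict-neutral).
Y. Zhang, *Discrete mean estimates and the Landau–Siegel zero*, arXiv:2211.02515v1 (2022)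
[Zhang2022LandauSiegel] — **an unrefereed manuscript under adjudication. Every `def … : Prop` below is
a CLAIM OF THE MANUSCRIPT, STATED NOT ASSERTED; nothing here asserts or denies its Theorems 1–2.**
Cell siegel-zhang (D-0069 width campaign), layer L4, slice L4-t3 = file `TypedSection15C` of
plan/FILES.tsv: the 27 DAG nodes `Z22:Lem15.1 … Z22:(15.24)` (plan/DAG.tsv ids, adopted verbatim),
i.e. the statement of Lemma 15.1 with its constants, the deduction (15.22)–(15.23) of the value of
`𝒮₁ⱼ`, Lemmas 15.2–15.3 (proved in Appendix A of the manuscript; "a sketch only" for 15.3), the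
values of `ℛ₁*`, `ℛ₁ⱼ`, `ℛ₁*ℛ₁ⱼ`, and (15.24). Locators `[Z22 p.<PDF page>, (display), tex L<line>]`
are read on the page images `pages/p0086–p0088.txt` of the cell's copy of v1 (the DAG's interpolated
pages for u047/u048/u055 are off by one; the pages below are the printed ones).

## What is typed, node by node (statements first; typed ≠ discharged ≠ true)

| DAG node | locator | decl here | kind |
|---|---|---|---|
| `Z22:Lem15.1` | p.86, L4273 | — (= `Skeleton.Lemma151 c′`, banked) | cite |
| `Z22:§15.u042` | p.86, L4274 | `Step15_u042` (+ `lemma151_iff`, `Iff.rfl`) | the display of Lemma 15.1, pointwise |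
| `Z22:§15.u043` | p.86, L4278 | `step15_u043` (`rfl` vs `frake`) | `𝔢ⱼ = (e₁ⱼ + ι₂e₂ⱼ)(ῑ₃e₃ⱼ + ῑ₄e₂ⱼ)` |
| `Z22:§15.u044`–`u047` | p.86, L4282–L4292 | `step15_u044` … `step15_u047` (`rfl` vs `e2j`, `e3j`, `e1j`, `e1pj`) | the printed constants |
| `Z22:§15.u048` | p.86, L4294 | `step15_u048` (`rfl` vs `e1ppj`; cf. `e1ppD`, `e1ppD_eq`) | `e″₁ⱼ` AS STATED (≠ the App. B derived value) |
| `Z22:(15.22)` | p.87, L4306 | `Eq15_22` | `𝒮₁ⱼ = 𝔢ⱼ𝓜₁(1,1;1−βⱼ)Σ_{n∈𝒩(𝒬),n<T} χ(n)τ₂(n)ϖ₁ⱼ(n)/n + O(1/𝓛)` |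
| `Z22:§15.u049` | p.87, L4310 | `Step15_u049` | `ϱ*ⱼ(q) = ϱⱼ(q) + O(ν(q)) ≪ α₁ + ν(q)` (`D⁴ < q < T`) |
| `Z22:§15.u050` | p.87, L4314 | `Step15_u050` | `Σ_{n∉𝒩(𝒬),n<T} … ≪ 1/𝓛` |
| `Z22:Lem15.2`, `§15.u051` | p.87, L4333–L4335 | `Lemma152`, `Step15_u051` (object `eulerM1`) | `𝓜₁(1,1;s) = ∏_{(q,D)=1}(1−χ(q)q⁻²)/(1−q⁻²) + O(α₁)`, `|s−1| < 5α` |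
| `Z22:Lem15.3`, `§15.u052`, `§15.u053` | p.87, L4344–L4350 | `Lemma153`, `calU1` (+ `IsCalU1`), `Step15_u053` (object `eulerU1`) | `𝒰₁ⱼ` analytic and bounded for `σ ≥ 9/10`; `𝒰₁ⱼ(1) = φ(D)²D⁻²∏(1−q⁻²)²/(1−χ(q)q⁻²) + O(α₁)` |
| `Z22:§15.u054` | p.87, L4354 | `Step15_u054` (objects `sumLtT`, `sumWeighted`, `mellinIntegrand`, `mellinIntegral`) | "By (4.2) and (4.3)" — smoothing and Mellin inversion |
| `Z22:§15.u055` | p.87, L4360 | `Step15_u055` | `Σ_{n<T} … = L′(1,χ)²𝒰₁ⱼ(1) + O(α₁)` ("as in the proof of Lemma 8.4") |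
| `Z22:§15.u056` | p.88, L4364 | `Step15_u056` | `𝓜₁(1,1;1−βⱼ)Σ_{n∈𝒩(𝒬),n<T} … = 𝔞φ(D)/D + O(1/𝓛³)` |
| `Z22:§15.u057` | p.88, L4368 | `Step15_u057` | `φ(D)D⁻¹∏_{(q,D)=1}(1−q⁻²) = (6/π²)∏_{q∣D} q/(q+1)` |
| `Z22:(15.23)` | p.88, L4372 | `Eq15_23` | `𝒮₁ⱼ = 𝔢ⱼ𝔞φ(D)/D + O(1/𝓛³)` |
| `Z22:§15.u058` | p.88, L4377 | `Step15_u058` | "By Lemma 5.8, `ℛ₁* = β₁β₂L′(1,χ) + O(1/𝓛²⁴)`" |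
| `Z22:§15.u059` | p.88, L4381 | `Step15_u059` | `ℛ₁ⱼ = P₄^{β₃−βⱼ}/((β_{j+1}−βⱼ)(β_{j+2}−βⱼ)L′(1,χ)) + O(1/𝓛³)` |
| `Z22:§15.u060`–`u062` | p.88, L4385–L4392 | `Step15_u060`, `Step15_u061`, `Step15_u062` | `ℛ₁*ℛ₁₁ = 1 + O(1/𝓛)`, `ℛ₁*ℛ₁₂ = 2 + O(1/𝓛)`, `ℛ₁*ℛ₁₃ = 1 + O(1/𝓛)` |
| `Z22:(15.24)` | p.88, L4395 | — (= `Skeleton.Eval1524 c′`, banked; coarse deduction `Skeleton.Ded1524 c′`) | cite |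

All displays from (15.22) on refine the banked coarse deduction node `Skeleton.Ded1524 c′`
("Prop. 14.1 + Lemma 5.5 + Lemma 5.8 + Lemma 15.1 (+ Lemmas 15.2–15.3) ⇒ (15.24)"): the printed
chain is (15.6) + (15.17) + (15.23) + (`ℛ₁*ℛ₁ⱼ` values) ⇒ (15.24), with (15.6)/(15.17) typed in the
sibling slices `TypedSection15A/B`.

## Interface (what is CITED, what is a parameter)

Banked objects are used by their tree names (`open …Zhang2022.Skeleton`): `𝓛 = ell D`, `α = alpha D`,
`α₁ = α𝓛` (undefined in v1; the skeleton's reading `alpha D * ell D`), `T = bigT D`, `P₄ = P4 D`,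
`βⱼ = betaJ c′ D j` (index mod 3, so `β₄ = β₁`, `β₅ = β₂`), `β₁,β₂,β₃ = beta1/2/3 c′ D`,
`𝒩(d) = nset d`, `𝒬 = frakq D`, `ν = nu χ`, `ϱ*ⱼ = varrhoStar c′ χ j`, `b(n) = bcoef D n`,
`𝔞 = frakA χ`, `g = gW D` ((4.1)), `ω₁ = GaussWeight.omega1 (𝓛³⁰)`; the constants `𝔢ⱼ, e₂ⱼ, e₃ⱼ, e₁ⱼ,
e′₁ⱼ, e″₁ⱼ, ι₂, ι₃, ι₄` are `Section18Defs`' `frake, e2j, e3j, e1j, e1pj, e1ppj, iota2/3/4`;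
`τ₂(n)` = `n.divisors.card` (as in `Skeleton.Lemma151`); `L′(1,χ) = deriv χ.LFunction 1`;
`φ = Nat.totient`. The objects INTRODUCED in §15 parts A–B and in Appendix B (owners: slices
`TypedSection15A` (L4-t1), `TypedSection15B` (L4-t2), `TypedAppendixB` (L4-t10) of the campaign) —
`𝓜₁(d,l;s)`, `ϖ₁ⱼ(n)`, `𝒮₁ⱼ`, `ℛ₁*`, `ℛ₁ⱼ`, `ϱⱼ(n)` — are NOT re-declared here: following the tree's
hypothesis-structure convention (cf. `Literature.AnabelianGeometry.EtaleTheta.DivisorMonoids`'s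
`FrdIMonoidStub`), they are carried by ONE explicit parameter `X : Inputs15AB` whose fields quote
the owners' printed definitions — and, now that the sibling files have landed, INSTANTIATED in
§ MERGE at the end of this file: `inputs15AB` := the landed `Typed.Section15B.calM1 / varpi1 / calS1
(at the printed coefficients `Typed.Section15A.bLit`) / calR1`, `Typed.Section15A.calR1star`,
`Typed.AppendixB.varrhoJ` (cited by import, not restated); the `…I` abbreviations (`Lemma152I c′`,
`Eq15_22I c′`, …) are the closed readings of the nodes about the manuscript's own objects. Two further
NOT-PRINTED families ride along for the discharge lane: the repair candidates `…R` of the cell's GAP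
rows G-L4t3-1/2/3 and the sharpened `ℛ₁*ℛ₁ⱼ` error terms `…S` of its RULING 9 (family G-d49-1),
each with a proved edge to or from the printed node where one exists. The one object introduced in THIS slice, `𝒰₁ⱼ(s)` (u052), is defined
(`calU1`, the printed Dirichlet series, meaningful for `σ > 1`), and Lemma 15.3's "analytic and
bounded for `σ ≥ 9/10`" is typed as the existence of an analytic continuation `U` (`IsCalU1`), in
terms of which `𝒰₁ⱼ(1)` is read (the continuation is unique when it exists).

## Print defects inside this slice (typed as the context demands, flagged here and in the docstrings)

* Lemma 15.3 introduces `𝒰₁ⱼ` but its second display, and the two displays after it (u054, u055),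
  write `𝒰₂ⱼ` (tex L4350, L4356, L4361) — a §16 symbol (`𝒰₂ⱼ` is introduced at tex L4675); typed
  with `𝒰₁ⱼ` ("printed `𝒰₂ⱼ`, context `𝒰₁ⱼ`").
* `e″₁ⱼ` of Lemma 15.1 as STATED (`e1ppj`) differs from the value the Appendix-B proof derives
  (`AppendixB.e1ppD`, `e1ppD_eq : e1ppD j = −jπi·b*`); u048 types the statement, cites both.
* `α₁` is not defined in v1 (read `α𝓛`, as in the skeleton); `ϱⱼ` is used at u049 (p.87) before
  its definition in Appendix B (p.106, tex L5250).

## References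

* Y. Zhang, arXiv:2211.02515v1 (2022), §15 pp. 86–88 (Lemma 15.1, (15.22)–(15.24), Lemmas
  15.2–15.3), Appendix A pp. 104–105, Appendix B p.106. [cite: Zhang2022LandauSiegel, §15 pp.86–88]
-/

noncomputable section

open Complex Real ComplexConjugate
open Literature.NumberTheory.LFunctions.Zhang2022.Skeleton

namespace Literature.NumberTheory.LFunctions.Zhang2022.Typed.Section15C

/-! ## The §15A/§15B/App. B objects consumed here, as ONE hypothesis structure -/

/-- The objects of §15 parts A–B and Appendix B that §15C consumes, carried as an explicit
HYPOTHESIS STRUCTURE so that every statement below is parametric in them and nothing owned by a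
sibling slice is re-declared (merge pass: instantiate with the landed definitions of
`Typed.Section15A`, `Typed.Section15B`, `Typed.AppendixB`). Each field takes the constant `c′` of
(2.13) and the exceptional character `χ (mod D)` and quotes the owner's printed definition.
[cite: Zhang2022LandauSiegel, §15 pp.83–86] -/
structure Inputs15AB where
  /-- **`𝓜₁(d,l;s)`** (§15 p.84, display before (15.15), tex L4206): "`𝓜₁(d,l;s) :=
  ζ(s)L(s,χ)/(ζ(s+β₁)ζ(s+β₂)) · Σₙ λ̃₁(n,d)ξ₁(n;d,l)n^{−s}` is analytic and satisfies
  `𝓜₁(d,l;s) ≪ ∏_{q∣dl}(1 + cq^{−9/10})` for `σ > 9/10`" (arguments `c′ χ d l s`).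
  TODO-merge(sz-L4-t2, `Typed.Section15B`). -/
  calM1 : ℝ → ∀ {D : ℕ} [NeZero D], DirichletCharacter ℂ D → ℕ → ℕ → ℂ → ℂ
  /-- **`ϖ₁ⱼ(n) = Σ_{n=dl} λ₁(d)d^{βⱼ}χ(l)𝓜₁(d,l;1−βⱼ)/𝓜₁(1,1;1−βⱼ)`** (§15 p.85, display after
  (15.19), tex L4245; "a multiplicative function") (arguments `c′ χ j n`).
  TODO-merge(sz-L4-t2, `Typed.Section15B`). -/
  varpi1 : ℝ → ∀ {D : ℕ} [NeZero D], DirichletCharacter ℂ D → ℕ → ℕ → ℂ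
  /-- **`𝒮₁ⱼ = Σₙ b(n)n⁻¹ Σ_{n=dl} λ₁(d)d^{βⱼ}χ(l)𝓜₁(d,l;1−βⱼ)`** (§15 p.85, display after (15.17),
  tex L4231) (arguments `c′ χ j`). TODO-merge(sz-L4-t2, `Typed.Section15B`). -/
  calS1 : ℝ → ∀ {D : ℕ} [NeZero D], DirichletCharacter ℂ D → ℕ → ℂ
  /-- **`ℛ₁* = L(1+β₁,χ)L(1+β₂,χ)δ(1)/L′(1,χ)`** (§15 p.83, display after (15.10), tex L4136)
  (arguments `c′ χ`). TODO-merge(sz-L4-t1, `Typed.Section15A`). -/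
  calR1star : ℝ → ∀ {D : ℕ} [NeZero D], DirichletCharacter ℂ D → ℂ
  /-- **`ℛ₁ⱼ`** (`1 ≤ j ≤ 3`) = "the residue of the function
  `ζ(1+s+β₁)ζ(1+s+β₂)/(ζ(1+s)L(1+s,χ)) · P₄^{s+β₃}ω₁(s+β₃)/(s+β₃)` (15.16) at `s = −βⱼ`"
  (§15 p.85, tex L4221–L4225) (arguments `c′ χ j`). TODO-merge(sz-L4-t2, `Typed.Section15B`). -/
  calR1 : ℝ → ∀ {D : ℕ} [NeZero D], DirichletCharacter ℂ D → ℕ → ℂ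
  /-- **`ϱⱼ(n) = Σ_{d∣n} μ(d)d^{βⱼ}`** (Appendix B p.106, tex L5250; used already at §15 p.87)
  (arguments `c′ χ j n`). TODO-merge(sz-L4-t10, `Typed.AppendixB`). -/
  varrho : ℝ → ∀ {D : ℕ} [NeZero D], DirichletCharacter ℂ D → ℕ → ℕ → ℂ

variable (c' : ℝ) (X : Inputs15AB)

/-! ## Lemma 15.1 (cite `Skeleton.Lemma151`) and its constants (u042–u048) -/

section LemmaFifteenOne

variable {D : ℕ} [NeZero D] (χ : DirichletCharacter ℂ D)

/-- **Z22:§15.u042** — the display of Lemma 15.1 (§15 p.86, tex L4274), POINTWISE in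
`(D, χ, j, n₁)` with an explicit implied constant `C`:
"`Σ_{(n,𝒬)=1} b(n₁n)χ(n)ϱ*ⱼ(n)/n = χ(n₁)τ₂(n₁)𝔢ⱼ + O(α₁τ₂(n₁))`" (the `n`-sum finite by (15.2),
`n < P`; `α₁ = α𝓛`). This is exactly the kernel of the banked node `Skeleton.Lemma151 c′`
(`lemma151_iff`); it is NOT a second statement of the lemma. CLAIM.
[cite: Zhang2022LandauSiegel, §15 Lemma 15.1 p.86] -/
def Step15_u042 (j n₁ : ℕ) (C : ℝ) : Prop :=
  ‖(∑ n ∈ (Finset.Ico 1 ⌈bigP D⌉₊).filter (fun n => Nat.Coprime n (frakq D)),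
        bcoef D (n₁ * n) * χ (n : ZMod D) * varrhoStar c' χ j n / (n : ℂ)) -
      χ (n₁ : ZMod D) * (n₁.divisors.card : ℂ) * frake j‖ ≤
    C * alpha D * ell D * n₁.divisors.card

omit [NeZero D] χ in
/-- **Z22:Lem15.1 = `Skeleton.Lemma151 c′`** (§15 p.86, tex L4273): the banked node unfolds,
definitionally, to "`∃ C`, for all large `D`, under (A), for `j ∈ {1,2,3}`, `n₁ ∈ 𝒩(𝒬)`, `n₁ < T`:
u042". [cite: Zhang2022LandauSiegel, §15 Lemma 15.1 p.86] -/
theorem lemma151_iff :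
    Skeleton.Lemma151 c' ↔ ∃ C : ℝ, ForAllLarge fun D _ χ => AssumptionA D χ →
      ∀ j ∈ ({1, 2, 3} : Finset ℕ), ∀ n₁ : ℕ, n₁ ∈ nset (frakq D) → (n₁ : ℝ) < bigT D →
        Step15_u042 c' χ j n₁ C :=
  Iff.rfl

/-- **Z22:§15.u043** (§15 p.86, tex L4278): "`𝔢ⱼ = (e₁ⱼ + ι₂e₂ⱼ)(ῑ₃e₃ⱼ + ῑ₄e₂ⱼ)`" — the display
is the tree's definition `frake j` (`Section18Defs`), checked by `rfl`.
[cite: Zhang2022LandauSiegel, §15 Lemma 15.1 p.86] -/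
theorem step15_u043 (j : ℕ) :
    frake j = (e1j j + iota2 * e2j j) * (conj iota3 * e3j j + conj iota4 * e2j j) := rfl

/-- **Z22:§15.u044** (§15 p.86, tex L4282): "`e₂ⱼ = (1 − 2j/5 + 8j/(25πi))exp{5πi/4} − 8j/(25πi)`"
= the tree's `e2j j`, by `rfl`. [cite: Zhang2022LandauSiegel, §15 Lemma 15.1 p.86] -/
theorem step15_u044 (j : ℕ) :
    e2j j = (1 - 2 * (j : ℂ) / 5 + 8 * (j : ℂ) / (25 * π * I)) * cexp (5 * π * I / 4) -
      8 * (j : ℂ) / (25 * π * I) := rfl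

/-- **Z22:§15.u045** (§15 p.86, tex L4285):
"`e₃ⱼ = (1 − 2j/3 + j/(1.1205πi))exp{0.747πi} − j/(1.1205πi)`" = the tree's `e3j j`, by `rfl`.
[cite: Zhang2022LandauSiegel, §15 Lemma 15.1 p.86] -/
theorem step15_u045 (j : ℕ) :
    e3j j = (1 - 2 * (j : ℂ) / 3 + (j : ℂ) / (1.1205 * π * I)) * cexp (0.747 * π * I) -
      (j : ℂ) / (1.1205 * π * I) := rfl

/-- **Z22:§15.u046** (§15 p.86, tex L4289): "`e₁ⱼ = e′₁ⱼ − e″₁ⱼ`" = the tree's `e1j j`, by `rfl`.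
[cite: Zhang2022LandauSiegel, §15 Lemma 15.1 p.86] -/
theorem step15_u046 (j : ℕ) : e1j j = e1pj j - e1ppj j := rfl

/-- **Z22:§15.u047** (§15 p.86, tex L4292):
"`e′₁ⱼ = (1 − 2j/3 + j/(1.134πi))exp{0.756πi} − j/(1.134πi)`" = the tree's `e1pj j`, by `rfl`.
[cite: Zhang2022LandauSiegel, §15 Lemma 15.1 p.86] -/
theorem step15_u047 (j : ℕ) :
    e1pj j = (1 - 2 * (j : ℂ) / 3 + (j : ℂ) / (1.134 * π * I)) * cexp (0.756 * π * I) -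
      (j : ℂ) / (1.134 * π * I) := rfl

/-- **Z22:§15.u048** (§15 p.86, tex L4294–L4296), AS STATED:
"`e″₁ⱼ = (j/0.756)∫₀^{0.004}(exp{(3/2)(0.504−z)πi} − exp{(3/4)πi})dz`" = the tree's `e1ppj j`, by
`rfl`. FLAG (print defect of record): the last display of the Appendix-B proof of (B.3) derives a
DIFFERENT number, the tree's `e1ppD j` (`AppendixB.e1ppD_eq : e1ppD j = −jπi·b*`); this node types
the statement, not the derivation. [cite: Zhang2022LandauSiegel, §15 Lemma 15.1 p.86] -/
theorem step15_u048 (j : ℕ) :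
    e1ppj j = (j : ℂ) / 0.756 *
      ∫ z in (0:ℝ)..0.004, (cexp (3 / 2 * (0.504 - z) * π * I) - cexp (3 / 4 * π * I)) := rfl

end LemmaFifteenOne

/-! ## The finite sums of (15.22)–(15.23) and of the displays p.87–88 (objects) -/

section Sums

variable {D : ℕ} [NeZero D] (χ : DirichletCharacter ℂ D)

open scoped Classical in
/-- `Σ_{n∈𝒩(𝒬), n<T} χ(n)τ₂(n)ϖ₁ⱼ(n)/n` — the sum on the right of (15.22) (§15 p.87, tex L4307)
(`n < T` ⇔ `n ∈ [1, ⌈T⌉)`). [cite: Zhang2022LandauSiegel, §15 (15.22) p.87] -/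
def sumInN (j : ℕ) : ℂ :=
  ∑ n ∈ (Finset.Ico 1 ⌈bigT D⌉₊).filter (fun n => n ∈ nset (frakq D)),
    χ (n : ZMod D) * (n.divisors.card : ℂ) * X.varpi1 c' χ j n / (n : ℂ)

open scoped Classical in
/-- `Σ_{n∉𝒩(𝒬), n<T} χ(n)τ₂(n)ϖ₁ⱼ(n)/n` (§15 p.87, tex L4315).
[cite: Zhang2022LandauSiegel, §15 p.87] -/
def sumNotInN (j : ℕ) : ℂ :=
  ∑ n ∈ (Finset.Ico 1 ⌈bigT D⌉₊).filter (fun n => n ∉ nset (frakq D)),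
    χ (n : ZMod D) * (n.divisors.card : ℂ) * X.varpi1 c' χ j n / (n : ℂ)

/-- `Σ_{n<T} χ(n)τ₂(n)ϖ₁ⱼ(n)/n` (§15 p.87, tex L4355, left side).
[cite: Zhang2022LandauSiegel, §15 p.87] -/
def sumLtT (j : ℕ) : ℂ :=
  ∑ n ∈ Finset.Ico 1 ⌈bigT D⌉₊,
    χ (n : ZMod D) * (n.divisors.card : ℂ) * X.varpi1 c' χ j n / (n : ℂ)

/-- `Σₙ χ(n)τ₂(n)ϖ₁ⱼ(n)n⁻¹ g(T/n)` (§15 p.87, tex L4355, right side; `g` of (4.1) = `gW D`), as a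
series over `n ≥ 1` (the `n = 0` term vanishes: `τ₂(0) = 0`). [cite: Zhang2022LandauSiegel, §15 p.87] -/
def sumWeighted (j : ℕ) : ℂ :=
  ∑' n : ℕ, χ (n : ZMod D) * (n.divisors.card : ℂ) * X.varpi1 c' χ j n / (n : ℂ) *
    (gW D (bigT D / n) : ℂ)

end Sums

/-! ## (15.22) and the two remarks after it (p.87) -/

section FifteenTwentyTwo

/-- **Z22:(15.22)** (§15 p.87, tex L4306–L4307): "By (15.19)–(15.21) and Lemma 15.1 we obtain
`𝒮₁ⱼ = 𝔢ⱼ𝓜₁(1,1;1−βⱼ) Σ_{n∈𝒩(𝒬), n<T} χ(n)τ₂(n)ϖ₁ⱼ(n)/n + O(1/𝓛)`" (`1 ≤ j ≤ 3`).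
Refines `Skeleton.Ded1524 c′`. CLAIM. [cite: Zhang2022LandauSiegel, §15 (15.22) p.87] -/
def Eq15_22 : Prop :=
  ∃ C : ℝ, ForAllLarge fun D _ χ => AssumptionA D χ → ∀ j ∈ ({1, 2, 3} : Finset ℕ),
    ‖X.calS1 c' χ j - frake j * X.calM1 c' χ 1 1 (1 - betaJ c' D j) * sumInN c' X χ j‖ ≤
      C / ell D

/-- **Z22:§15.u049** (§15 p.87, tex L4310–L4311): "(15.22) remains valid if the constraint
`n ∈ 𝒩(𝒬)` is removed, since, for `D⁴ < q < T`, `ϱ*ⱼ(q) = ϱⱼ(q) + O(ν(q)) ≪ α₁ + ν(q)`" (`q`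
prime; `ν = 1 ∗ χ`; `ϱⱼ` of Appendix B; both relations of the display typed, with one constant).
FLAG (typing note, not a verdict): for a prime `q < T = exp 𝓛^{1.1}` one has `|q^{βⱼ} − 1| ≤ 3α𝓛^{1.1}
= 3α₁𝓛^{0.1}`, so the printed `≪ α₁ + ν(q)` (with `ϱⱼ(q) = 1 − q^{βⱼ}`) is typed AS PRINTED although
the visible bound is `α₁𝓛^{0.1} + ν(q)` (immaterial for u050). CLAIM. [cite: Zhang2022LandauSiegel, §15 p.87] -/
def Step15_u049 : Prop :=
  ∃ C : ℝ, ForAllLarge fun D _ χ => AssumptionA D χ → ∀ j ∈ ({1, 2, 3} : Finset ℕ),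
    ∀ q : ℕ, q.Prime → D ^ 4 < q → (q : ℝ) < bigT D →
      ‖varrhoStar c' χ j q - X.varrho c' χ j q‖ ≤ C * ‖nu χ q‖ ∧
        ‖varrhoStar c' χ j q‖ ≤ C * (alpha D * ell D + ‖nu χ q‖)

/-- **Z22:§15.u050** (§15 p.87, tex L4314–L4315): "This yields, by (15.21),
`Σ_{n∉𝒩(𝒬), n<T} χ(n)τ₂(n)ϖ₁ⱼ(n)/n ≪ 1/𝓛`." CLAIM. [cite: Zhang2022LandauSiegel, §15 p.87] -/
def Step15_u050 : Prop :=
  ∃ C : ℝ, ForAllLarge fun D _ χ => AssumptionA D χ → ∀ j ∈ ({1, 2, 3} : Finset ℕ),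
    ‖sumNotInN c' X χ j‖ ≤ C / ell D

end FifteenTwentyTwo

/-! ## Lemma 15.2 (p.87; proved in Appendix A, tex L5118–L5167) -/

section LemmaFifteenTwo

variable {D : ℕ} [NeZero D] (χ : DirichletCharacter ℂ D)

omit [NeZero D] in
/-- The Euler product `∏_{(q,D)=1} (1 − χ(q)q⁻²)/(1 − q⁻²)` of Lemma 15.2 (§15 p.87, tex L4335), over
the primes `q` coprime to `D` (absolutely convergent). [cite: Zhang2022LandauSiegel, §15 Lemma 15.2 p.87] -/
def eulerM1 : ℂ :=
  ∏' p : Nat.Primes, if Nat.Coprime (p : ℕ) D then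
    (1 - χ ((p : ℕ) : ZMod D) / ((p : ℕ) : ℂ) ^ 2) / (1 - 1 / ((p : ℕ) : ℂ) ^ 2) else 1

/-- **Z22:§15.u051** — the display of Lemma 15.2 (§15 p.87, tex L4334–L4335), pointwise in `s` with
an explicit implied constant: "`𝓜₁(1,1;s) = ∏_{(q,D)=1}(1 − χ(q)q⁻²)/(1 − q⁻²) + O(α₁)`" (`α₁ = α𝓛`).
CLAIM. [cite: Zhang2022LandauSiegel, §15 Lemma 15.2 p.87] -/
def Step15_u051 (s : ℂ) (C : ℝ) : Prop :=
  ‖X.calM1 c' χ 1 1 s - eulerM1 χ‖ ≤ C * (alpha D * ell D)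

end LemmaFifteenTwo

/-- **Z22:Lem15.2 — Lemma 15.2** (§15 p.87, tex L4333–L4335; "will be proved in Appendix A",
proof at pp.104–105): "If `|s − 1| < 5α`, then `𝓜₁(1,1;s) = ∏_{(q,D)=1}(1−χ(q)q⁻²)/(1−q⁻²) + O(α₁)`."
A NEW node (the skeleton folds Lemmas 15.2–15.3 into `Skeleton.Ded1524 c′`). CLAIM.
[cite: Zhang2022LandauSiegel, §15 Lemma 15.2 p.87] -/
def Lemma152 : Prop :=
  ∃ C : ℝ, ForAllLarge fun D _ χ => AssumptionA D χ →
    ∀ s : ℂ, ‖s - 1‖ < 5 * alpha D → Step15_u051 c' X χ s C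

/-! ## Lemma 15.3 (p.87; "a sketch only" in Appendix A, tex L5172–L5185) -/

section LemmaFifteenThree

variable {D : ℕ} [NeZero D] (χ : DirichletCharacter ℂ D)

/-- **Z22:§15.u052 — the object `𝒰₁ⱼ(s)`** (§15 p.87, tex L4345–L4346), AS PRINTED:
"`𝒰₁ⱼ(s) := (ζ(s)²L(s,χ)²)⁻¹ Σₙ χ(n)τ₂(n)ϖ₁ⱼ(n)n^{−s}`", the `n`-series as a `tsum` over `n ≥ 1`
(the `n = 0` term vanishes). The series converges absolutely for `σ > 1` only; Lemma 15.3's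
"analytic and bounded for `σ ≥ 9/10`" is a statement about its analytic continuation, typed via
`IsCalU1`. [cite: Zhang2022LandauSiegel, §15 Lemma 15.3 p.87] -/
def calU1 (j : ℕ) (s : ℂ) : ℂ :=
  (riemannZeta s ^ 2 * χ.LFunction s ^ 2)⁻¹ *
    ∑' n : ℕ, χ (n : ZMod D) * (n.divisors.card : ℂ) * X.varpi1 c' χ j n / (n : ℂ) ^ s

/-- "`U` is the analytic continuation of `𝒰₁ⱼ` to `σ ≥ 9/10`": `U` is analytic at every point of
the closed half-plane `Re s ≥ 9/10` and agrees with the series `calU1` on `Re s > 1` (such a `U` is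
unique if it exists, by the identity theorem). [cite: Zhang2022LandauSiegel, §15 Lemma 15.3 p.87] -/
def IsCalU1 (j : ℕ) (U : ℂ → ℂ) : Prop :=
  AnalyticOnNhd ℂ U {s : ℂ | 9 / 10 ≤ s.re} ∧ ∀ s : ℂ, 1 < s.re → U s = calU1 c' X χ j s

omit [NeZero D] in
/-- The Euler product `∏_{(q,D)=1} (1 − q⁻²)²/(1 − χ(q)q⁻²)` of Lemma 15.3 (§15 p.87, tex L4350).
[cite: Zhang2022LandauSiegel, §15 Lemma 15.3 p.87] -/
def eulerU1 : ℂ :=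
  ∏' p : Nat.Primes, if Nat.Coprime (p : ℕ) D then
    (1 - 1 / ((p : ℕ) : ℂ) ^ 2) ^ 2 / (1 - χ ((p : ℕ) : ZMod D) / ((p : ℕ) : ℂ) ^ 2) else 1

end LemmaFifteenThree

/-- **Z22:§15.u053** — the second display of Lemma 15.3 (§15 p.87, tex L4349–L4350):
"`𝒰₂ⱼ(1) = φ(D)²D⁻² ∏_{(q,D)=1}(1 − q⁻²)²/(1 − χ(q)q⁻²) + O(α₁)`" — FLAG: printed `𝒰₂ⱼ`, context
`𝒰₁ⱼ` (the function the lemma has just introduced; `𝒰₂ⱼ` is a §16 symbol); `𝒰₁ⱼ(1)` is read as the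
value at `1` of the analytic continuation (`IsCalU1`). CLAIM. [cite: Zhang2022LandauSiegel, §15 Lemma 15.3 p.87] -/
def Step15_u053 : Prop :=
  ∃ C : ℝ, ForAllLarge fun D _ χ => AssumptionA D χ → ∀ j ∈ ({1, 2, 3} : Finset ℕ),
    ∀ U : ℂ → ℂ, IsCalU1 c' X χ j U →
      ‖U 1 - (Nat.totient D : ℂ) ^ 2 / (D : ℂ) ^ 2 * eulerU1 χ‖ ≤ C * (alpha D * ell D)

/-- **Z22:Lem15.3 — Lemma 15.3** (§15 p.87, tex L4344–L4350; Appendix A gives "a sketch only",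
pp.105): "For `σ ≥ 9/10` the function `𝒰₁ⱼ(s) := (ζ(s)²L(s,χ)²)⁻¹Σₙ χ(n)τ₂(n)ϖ₁ⱼ(n)n^{−s}` is
analytic and bounded. Further we have `𝒰₂ⱼ(1) = φ(D)²D⁻²∏_{(q,D)=1}(1−q⁻²)²/(1−χ(q)q⁻²) + O(α₁)`"
(`1 ≤ j ≤ 3`; printed `𝒰₂ⱼ`, context `𝒰₁ⱼ`). First part typed as: the series has an analytic
continuation to `Re s ≥ 9/10`, bounded there by a constant independent of `D` (the uniform reading
"`≪ 1`" that the contour shift of u055 consumes); second part = `Step15_u053`. A NEW node (folded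
into `Skeleton.Ded1524 c′` by the skeleton). FLAG (typing note for the adjudication — a candidate,
not a verdict; typed AS PRINTED): with `ϖ₁ⱼ(q) = χ(q) + q^{βⱼ}λ₁(q) + O(1/q)` at the primes
((15.18)–(15.21)), the printed series is `(L(s−βⱼ,χ)/L(s,χ))²` times an Euler product absolutely
convergent for `σ > 1/2`; so "analytic for `σ ≥ 9/10`" presupposes that `L(s,χ)` has no zero there
(under (A) there is the exceptional zero `ρ̃` of Lemma 5.5), and `𝒰₁ⱼ(1)` carries the factor
`(L(1−βⱼ,χ)/L(1,χ))²`, which (A) makes large; the prefactor `(ζ(s)²L(s−βⱼ,χ)²)⁻¹` would cancel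
exactly (as `ζ(s)L(s,χ)` does in `𝓜₁`). Reported to the cell's GAP ledger as a candidate.
CLAIM. [cite: Zhang2022LandauSiegel, §15 Lemma 15.3 p.87] -/
def Lemma153 : Prop :=
  (∃ C : ℝ, ForAllLarge fun D _ χ => AssumptionA D χ → ∀ j ∈ ({1, 2, 3} : Finset ℕ),
      ∃ U : ℂ → ℂ, IsCalU1 c' X χ j U ∧ ∀ s : ℂ, 9 / 10 ≤ s.re → ‖U s‖ ≤ C) ∧
    Step15_u053 c' X

/-! ## From (15.22) to (15.23) (pp.87–88) -/

section Contour

variable {D : ℕ} [NeZero D] (χ : DirichletCharacter ℂ D)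

/-- The integrand of the display "By (4.2) and (4.3)" (§15 p.87, tex L4356):
`ζ(1+s)²L(1+s,χ)²𝒰₁ⱼ(1+s)Tˢω₁(s)/s` (printed `𝒰₂ⱼ`; `ω₁(s) = exp{s²/(4𝓛³⁰)}` of §4), on the line
`Re s = 1` where `𝒰₁ⱼ(1+s)` is the convergent series `calU1`. [cite: Zhang2022LandauSiegel, §15 p.87] -/
def mellinIntegrand (j : ℕ) (s : ℂ) : ℂ :=
  riemannZeta (1 + s) ^ 2 * χ.LFunction (1 + s) ^ 2 * calU1 c' X χ j (1 + s) *
    (bigT D : ℂ) ^ s * GaussWeight.omega1 (ell D ^ 30) s / s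

/-- `(2πi)⁻¹∫_{(1)} ζ(1+s)²L(1+s,χ)²𝒰₁ⱼ(1+s)Tˢω₁(s)s⁻¹ds`, parametrised as
`(2π)⁻¹∫_ℝ f(1+it)dt` (§15 p.87, tex L4356). [cite: Zhang2022LandauSiegel, §15 p.87] -/
def mellinIntegral (j : ℕ) : ℂ :=
  ((1 / (2 * π) : ℝ) : ℂ) * ∫ t : ℝ, mellinIntegrand c' X χ j (1 + t * I)

end Contour

/-- **Z22:§15.u054** (§15 p.87, tex L4354–L4357): "By (4.2) and (4.3),
`Σ_{n<T} χ(n)τ₂(n)ϖ₁ⱼ(n)/n = Σₙ χ(n)τ₂(n)ϖ₁ⱼ(n)n⁻¹g(T/n) + O(α₁)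
= (2πi)⁻¹∫_{(1)} ζ(1+s)²L(1+s,χ)²𝒰₂ⱼ(1+s)Tˢω₁(s)ds/s + O(α₁)`" (printed `𝒰₂ⱼ`, context `𝒰₁ⱼ`);
typed as the two bounds `‖Σ_{n<T} − Σₙ…g‖ ≤ Cα₁`, `‖Σ_{n<T} − (2πi)⁻¹∫…‖ ≤ Cα₁`. CLAIM.
[cite: Zhang2022LandauSiegel, §15 p.87] -/
def Step15_u054 : Prop :=
  ∃ C : ℝ, ForAllLarge fun D _ χ => AssumptionA D χ → ∀ j ∈ ({1, 2, 3} : Finset ℕ),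
    ‖sumLtT c' X χ j - sumWeighted c' X χ j‖ ≤ C * (alpha D * ell D) ∧
      ‖sumLtT c' X χ j - mellinIntegral c' X χ j‖ ≤ C * (alpha D * ell D)

/-- **Z22:§15.u055** (§15 p.87, tex L4359–L4361): "By Lemma 15.3, we can move the contour of
integration in the same way as in the proof of Lemma 8.4 to obtain
`Σ_{n<T} χ(n)τ₂(n)ϖ₁ⱼ(n)/n = L′(1,χ)²𝒰₂ⱼ(1) + O(α₁)`" (printed `𝒰₂ⱼ`, context `𝒰₁ⱼ`; `𝒰₁ⱼ(1)` =
the continuation's value). CLAIM. [cite: Zhang2022LandauSiegel, §15 p.87] -/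
def Step15_u055 : Prop :=
  ∃ C : ℝ, ForAllLarge fun D _ χ => AssumptionA D χ → ∀ j ∈ ({1, 2, 3} : Finset ℕ),
    ∀ U : ℂ → ℂ, IsCalU1 c' X χ j U →
      ‖sumLtT c' X χ j - deriv χ.LFunction 1 ^ 2 * U 1‖ ≤ C * (alpha D * ell D)

/-- **Z22:§15.u056** (§15 p.88, tex L4363–L4365): "This together with Lemma 15.2 and 15.3 yields
`𝓜₁(1,1;1−βⱼ) Σ_{n∈𝒩(𝒬), n<T} χ(n)τ₂(n)ϖ₁ⱼ(n)/n = 𝔞φ(D)/D + O(1/𝓛³)`" (`𝔞` of (2.31) =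
`frakA χ`). CLAIM. [cite: Zhang2022LandauSiegel, §15 p.88] -/
def Step15_u056 : Prop :=
  ∃ C : ℝ, ForAllLarge fun D _ χ => AssumptionA D χ → ∀ j ∈ ({1, 2, 3} : Finset ℕ),
    ‖X.calM1 c' χ 1 1 (1 - betaJ c' D j) * sumInN c' X χ j -
        (frakA χ : ℂ) * (Nat.totient D : ℂ) / (D : ℂ)‖ ≤ C / ell D ^ 3

/-- **Z22:§15.u057** (§15 p.88, tex L4367–L4369): "since
`φ(D)D⁻¹ ∏_{(q,D)=1}(1 − q⁻²) = (6/π²) ∏_{q∣D} q/(q+1)`" — an exact identity for every modulus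
`D ≥ 1` (Euler's `∏_q(1 − q⁻²) = 6/π²`), typed over `ℝ` with the product over the primes coprime to
`D` as a `tprod`. CLAIM. [cite: Zhang2022LandauSiegel, §15 p.88] -/
def Step15_u057 : Prop :=
  ∀ D : ℕ, 0 < D →
    (Nat.totient D : ℝ) / D *
        (∏' p : Nat.Primes, if Nat.Coprime (p : ℕ) D then (1 - 1 / ((p : ℕ) : ℝ) ^ 2) else 1) =
      6 / π ^ 2 * ∏ q ∈ D.primeFactors, (q : ℝ) / (q + 1)

/-- **Z22:(15.23)** (§15 p.88, tex L4371–L4373): "It follows by (15.22) that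
`𝒮₁ⱼ = 𝔢ⱼ𝔞φ(D)/D + O(1/𝓛³)`" (`1 ≤ j ≤ 3`). Refines `Skeleton.Ded1524 c′`. FLAG (typing note):
the printed error `O(1/𝓛³)` is typed AS PRINTED although the cited input (15.22) carries `O(1/𝓛)`
(the step to (15.24) via (15.17) needs only `o(1)` here). CLAIM.
[cite: Zhang2022LandauSiegel, §15 (15.23) p.88] -/
def Eq15_23 : Prop :=
  ∃ C : ℝ, ForAllLarge fun D _ χ => AssumptionA D χ → ∀ j ∈ ({1, 2, 3} : Finset ℕ),
    ‖X.calS1 c' χ j - frake j * (frakA χ : ℂ) * (Nat.totient D : ℂ) / (D : ℂ)‖ ≤ C / ell D ^ 3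

/-! ## The values of `ℛ₁*`, `ℛ₁ⱼ`, `ℛ₁*ℛ₁ⱼ` (p.88) and (15.24) (cite `Skeleton.Eval1524`) -/

/-- **Z22:§15.u058** (§15 p.88, tex L4376–L4378): "By Lemma 5.8, `ℛ₁* = β₁β₂L′(1,χ) + O(1/𝓛²⁴)`"
(`β₁, β₂` of (2.13) with the constant `c′`; `L′(1,χ) = deriv L(·,χ) 1`). CLAIM.
[cite: Zhang2022LandauSiegel, §15 p.88] -/
def Step15_u058 : Prop :=
  ∃ C : ℝ, ForAllLarge fun D _ χ => AssumptionA D χ →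
    ‖X.calR1star c' χ - beta1 c' D * beta2 c' D * deriv χ.LFunction 1‖ ≤ C / ell D ^ 24

/-- **Z22:§15.u059** (§15 p.88, tex L4380–L4382): "and
`ℛ₁ⱼ = P₄^{β₃−βⱼ}/((β_{j+1} − βⱼ)(β_{j+2} − βⱼ)L′(1,χ)) + O(1/𝓛³)`" (`1 ≤ j ≤ 3`, indices mod 3:
`β₄ = β₁`, `β₅ = β₂`; `P₄ = PT⁻²t₀`). CLAIM. [cite: Zhang2022LandauSiegel, §15 p.88] -/
def Step15_u059 : Prop :=
  ∃ C : ℝ, ForAllLarge fun D _ χ => AssumptionA D χ → ∀ j ∈ ({1, 2, 3} : Finset ℕ),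
    ‖X.calR1 c' χ j - ((P4 D : ℝ) : ℂ) ^ (beta3 c' D - betaJ c' D j) /
        ((betaJ c' D (j + 1) - betaJ c' D j) * (betaJ c' D (j + 2) - betaJ c' D j) *
          deriv χ.LFunction 1)‖ ≤ C / ell D ^ 3

/-- **Z22:§15.u060** (§15 p.88, tex L4385–L4386): "Hence, by direct calculation,
`ℛ₁*ℛ₁₁ = 1 + O(1/𝓛)`." CLAIM. [cite: Zhang2022LandauSiegel, §15 p.88] -/
def Step15_u060 : Prop :=
  ∃ C : ℝ, ForAllLarge fun D _ χ => AssumptionA D χ →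
    ‖X.calR1star c' χ * X.calR1 c' χ 1 - 1‖ ≤ C / ell D

/-- **Z22:§15.u061** (§15 p.88, tex L4388–L4389): "`ℛ₁*ℛ₁₂ = 2 + O(1/𝓛)`." CLAIM.
[cite: Zhang2022LandauSiegel, §15 p.88] -/
def Step15_u061 : Prop :=
  ∃ C : ℝ, ForAllLarge fun D _ χ => AssumptionA D χ →
    ‖X.calR1star c' χ * X.calR1 c' χ 2 - 2‖ ≤ C / ell D

/-- **Z22:§15.u062** (§15 p.88, tex L4391–L4392): "`ℛ₁*ℛ₁₃ = 1 + O(1/𝓛)`." CLAIM.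
[cite: Zhang2022LandauSiegel, §15 p.88] -/
def Step15_u062 : Prop :=
  ∃ C : ℝ, ForAllLarge fun D _ χ => AssumptionA D χ →
    ‖X.calR1star c' χ * X.calR1 c' χ 3 - 1‖ ≤ C / ell D

/-- **Z22:(15.24) = `Skeleton.Eval1524 c′`** (§15 p.88, tex L4394–L4396): "Combining these relations
with (15.23), (15.17) and (15.6) we conclude `Φ₁ = (𝔢₁ + 2𝔢₂ + 𝔢₃)𝔞𝔓 + o(𝔓)`." The node is banked
(`Skeleton.Eval1524`, coarse deduction `Skeleton.Ded1524`); recorded here only as the printed list of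
inputs of the last step, by `rfl` on the banked statement (the combination `1·𝔢₁ + 2·𝔢₂ + 1·𝔢₃` is
the `ℛ₁*ℛ₁ⱼ` pattern `1, 2, 1` of u060–u062). [cite: Zhang2022LandauSiegel, §15 (15.24) p.88] -/
theorem eval1524_iff :
    Skeleton.Eval1524 c' ↔ ∀ ε : ℝ, 0 < ε → ForAllLarge fun D _ χ => AssumptionA D χ →
      ‖Phi1 c' χ - (frake 1 + 2 * frake 2 + frake 3) * frakA χ * frakP D‖ ≤ ε * frakP D :=
  Iff.rfl

/-! ## Discharge of `Z22:§15.u057`: Euler's `∏_q (1 − q⁻²) = 6/π²` restricted to `(q, D) = 1` -/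

section EulerIdentity

open _root_.Filter _root_.Topology

/-- **Euler's product for `ζ(2)`, real unconditional form over the primes**:
`HasProd (q ↦ 1 − q⁻²) (6/π²)` — from Mathlib's `riemannZeta_eulerProduct_hasProd` at `s = 2` and
`riemannZeta_two`, by passing to real parts of the partial products and inverting (the identity
`∏_q(1 − q⁻²) = 6/π²` invoked at §15 p.88, tex L4367–L4369). [cite: Zhang2022LandauSiegel, §15 p.88] -/
theorem hasProd_one_sub_inv_sq :
    HasProd (fun p : Nat.Primes => 1 - 1 / ((p : ℕ) : ℝ) ^ 2) (6 / π ^ 2) := by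
  have hC := riemannZeta_eulerProduct_hasProd (s := 2) (by norm_num)
  rw [riemannZeta_two] at hC
  simp only [HasProd, SummationFilter.unconditional_filter] at hC ⊢
  have hcast : ∀ s : Finset Nat.Primes,
      ∏ p ∈ s, (1 - ((p : ℕ) : ℂ) ^ (-(2 : ℂ)))⁻¹ =
        (((∏ p ∈ s, (1 - 1 / ((p : ℕ) : ℝ) ^ 2))⁻¹ : ℝ) : ℂ) := by
    intro s
    rw [← Finset.prod_inv_distrib]
    push_cast
    refine Finset.prod_congr rfl fun p _ => ?_
    have hp0 : ((p : ℕ) : ℂ) ≠ 0 := by exact_mod_cast p.prop.ne_zero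
    rw [Complex.cpow_neg, show (2 : ℂ) = ((2 : ℕ) : ℂ) by norm_num, Complex.cpow_natCast,
      one_div]
  have h1 : Tendsto (fun s : Finset Nat.Primes => (∏ p ∈ s, (1 - 1 / ((p : ℕ) : ℝ) ^ 2))⁻¹)
      atTop (𝓝 (π ^ 2 / 6)) := by
    have h2 : Tendsto (fun s : Finset Nat.Primes =>
        (((∏ p ∈ s, (1 - 1 / ((p : ℕ) : ℝ) ^ 2))⁻¹ : ℝ) : ℂ)) atTop (𝓝 ((π : ℂ) ^ 2 / 6)) :=
      hC.congr hcast
    have h3 := (Complex.continuous_re.tendsto _).comp h2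
    have hre : ((π : ℂ) ^ 2 / 6).re = π ^ 2 / 6 := by
      rw [show (π : ℂ) ^ 2 / 6 = ((π ^ 2 / 6 : ℝ) : ℂ) by push_cast; ring, Complex.ofReal_re]
    rw [hre] at h3
    refine h3.congr fun s => ?_
    simp only [Function.comp_apply, Complex.ofReal_re]
  have hπ : π ^ 2 / 6 ≠ 0 := by positivity
  have h4 := h1.inv₀ hπ
  simp only [inv_inv, inv_div] at h4
  exact h4

/-- **The Euler product over the primes coprime to `D`**: for `D ≥ 1`,
`∏_{(q,D)=1} (1 − q⁻²) = (6/π²) ∏_{q∣D} (1 − q⁻²)⁻¹` (the finitely many factors at `q ∣ D` removed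
from Euler's product; `hasProd_prod_of_ne_finset_one`, `HasProd.mul`) — the left side of the
display at §15 p.88, tex L4369. [cite: Zhang2022LandauSiegel, §15 p.88] -/
theorem tprod_coprime_one_sub_inv_sq {D : ℕ} (hD : 0 < D) :
    (∏' p : Nat.Primes, if Nat.Coprime (p : ℕ) D then (1 - 1 / ((p : ℕ) : ℝ) ^ 2) else 1) =
      6 / π ^ 2 * ∏ q ∈ D.primeFactors, (1 - 1 / (q : ℝ) ^ 2)⁻¹ := by
  classical
  -- work at the type `Subtype Nat.Prime` (= `Nat.Primes` by definition)
  set f : Subtype Nat.Prime → ℝ := fun p => 1 - 1 / ((p : ℕ) : ℝ) ^ 2 with hf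
  set h' : ℕ → ℝ := fun q => if q ∣ D then (1 - 1 / (q : ℝ) ^ 2)⁻¹ else 1 with hh'
  set h : Subtype Nat.Prime → ℝ := fun p => h' (p : ℕ) with hh
  set S : Finset (Subtype Nat.Prime) := D.primeFactors.subtype Nat.Prime with hS
  have hmemS : ∀ p : Subtype Nat.Prime, p ∈ S ↔ (p : ℕ) ∣ D := by
    intro p
    rw [hS, Finset.mem_subtype, Nat.mem_primeFactors]
    exact ⟨fun h => h.2.1, fun h => ⟨p.prop, h, hD.ne'⟩⟩
  have hhS : ∀ p ∉ S, h p = 1 := by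
    intro p hp
    rw [hmemS] at hp
    simp [hh, hh', hp]
  have hH : HasProd h (∏ p ∈ S, h p) := hasProd_prod_of_ne_finset_one hhS
  have hF : HasProd f (6 / π ^ 2) := hasProd_one_sub_inv_sq
  have hFH := hF.mul hH
  have hfne : ∀ p : Subtype Nat.Prime, f p ≠ 0 := by
    intro p
    have hp2 : (2 : ℝ) ≤ (p : ℕ) := by exact_mod_cast p.prop.two_le
    have : 1 / ((p : ℕ) : ℝ) ^ 2 < 1 := by
      rw [div_lt_one (by positivity)]; nlinarith
    simp only [hf]; linarith
  -- `f * h` is the coprime-restricted factor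
  have hprod : (fun p : Subtype Nat.Prime => if Nat.Coprime (p : ℕ) D then f p else 1) =
      fun p => f p * h p := by
    funext p
    by_cases hp : (p : ℕ) ∣ D
    · have hnc : ¬ Nat.Coprime (p : ℕ) D := by
        rw [Nat.Prime.coprime_iff_not_dvd p.prop]; exact fun h => h hp
      rw [if_neg hnc]
      simp only [hh, hh', hp, if_true]
      exact (mul_inv_cancel₀ (hfne p)).symm
    · have hc : Nat.Coprime (p : ℕ) D := (Nat.Prime.coprime_iff_not_dvd p.prop).mpr hp
      rw [if_pos hc]
      simp only [hh, hh', hp, if_false, mul_one]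
  have key : (∏' p : Subtype Nat.Prime, if Nat.Coprime (p : ℕ) D then f p else 1) =
      6 / π ^ 2 * ∏ p ∈ S, h p := by
    rw [hprod]; exact hFH.tprod_eq
  -- rewrite the finite correction over `D.primeFactors`
  have hfin : ∏ p ∈ S, h p = ∏ q ∈ D.primeFactors, (1 - 1 / (q : ℝ) ^ 2)⁻¹ := by
    rw [hS, hh, Finset.prod_subtype_eq_prod_filter, Finset.filter_true_of_mem fun q hq =>
      Nat.prime_of_mem_primeFactors hq]
    refine Finset.prod_congr rfl fun q hq => ?_
    simp [hh', Nat.dvd_of_mem_primeFactors hq]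
  rw [hfin] at key
  -- `Nat.Primes` is by definition `Subtype Nat.Prime`
  have key' : (∏' p : Nat.Primes, if Nat.Coprime (p : ℕ) D then f p else 1) =
      6 / π ^ 2 * ∏ q ∈ D.primeFactors, (1 - 1 / (q : ℝ) ^ 2)⁻¹ := key
  simpa [hf] using key'

/-- **Z22:§15.u057 DISCHARGED**: `φ(D)D⁻¹∏_{(q,D)=1}(1 − q⁻²) = (6/π²)∏_{q∣D} q/(q+1)` for every
`D ≥ 1` — Euler's `φ(D)/D = ∏_{q∣D}(1 − 1/q)` (Mathlib `Nat.totient_eq_mul_prod_factors`),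
`tprod_coprime_one_sub_inv_sq`, and `(1 − 1/q)(1 − 1/q²)⁻¹ = q/(q+1)`. Kernel-checked; the node is
a theorem, not only a claim. [cite: Zhang2022LandauSiegel, §15 p.88] -/
theorem step15_u057_holds : Step15_u057 := by
  intro D hD
  rw [tprod_coprime_one_sub_inv_sq hD]
  have hφ : (Nat.totient D : ℝ) / D = ∏ q ∈ D.primeFactors, (1 - 1 / (q : ℝ)) := by
    have h := congrArg (fun q : ℚ => (q : ℝ)) (Nat.totient_eq_mul_prod_factors D)
    simp only [Rat.cast_natCast, Rat.cast_mul, Rat.cast_prod, Rat.cast_sub, Rat.cast_one,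
      Rat.cast_inv] at h
    have hD' : (D : ℝ) ≠ 0 := by exact_mod_cast hD.ne'
    rw [div_eq_iff hD', h, mul_comm]
    simp only [one_div]
  rw [hφ, mul_comm, mul_assoc, ← Finset.prod_mul_distrib]
  congr 1
  refine Finset.prod_congr rfl fun q hq => ?_
  have hq2 : (2 : ℝ) ≤ q := by exact_mod_cast (Nat.prime_of_mem_primeFactors hq).two_le
  have hq0 : (q : ℝ) ≠ 0 := by positivity
  have hq1 : (q : ℝ) + 1 ≠ 0 := by positivity
  have hqm : (q : ℝ) - 1 ≠ 0 := by linarith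
  have hq' : (q : ℝ) ^ 2 - 1 ≠ 0 := by nlinarith
  field_simp
  ring

end EulerIdentity

/-! ## Repair candidates of the GAP rows G-L4t3-1/2/3 (NOT printed; the printed decls above stay)

The cell's GAP ledger (plan/GAP-LEDGER.md rows G-L4t3-1, -2, -3) records, for three displays of this
slice, the statement that the printed argument visibly supports in place of the printed one ("decl
wanted"). They are typed here as CLAIM-VARIANTS (suffix `R`) so that the discharge lane has kernel
targets; each docstring names its row; where the printed claim implies the variant, the edge is proved.
Nothing here is a statement of the manuscript. -/

section RepairCandidates

variable {D : ℕ} [NeZero D] (χ : DirichletCharacter ℂ D)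

/-- **Repair candidate of G-L4t3-1 — the object.** `𝒰₁ⱼ` with the prefactor
`(ζ(s)²L(s−βⱼ,χ)²)⁻¹` in place of the printed `(ζ(s)²L(s,χ)²)⁻¹` (tex L4346): by (15.18)–(15.21)
the series `Σₙ χ(n)τ₂(n)ϖ₁ⱼ(n)n^{−s}` has prime coefficients `2(1 + χ(q)q^{βⱼ}) + O(1/q)`, those of
`ζ(s)²L(s−βⱼ,χ)²`, so this quotient is the absolutely convergent Euler product `E(s)` whose local
factors `1 + O(q^{−2σ})` the Appendix-A sketch (tex L5172–L5185) computes. NOT PRINTED.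
[cite: Zhang2022LandauSiegel, §15 Lemma 15.3 p.87] -/
def calU1R (j : ℕ) (s : ℂ) : ℂ :=
  (riemannZeta s ^ 2 * χ.LFunction (s - betaJ c' D j) ^ 2)⁻¹ *
    ∑' n : ℕ, χ (n : ZMod D) * (n.divisors.card : ℂ) * X.varpi1 c' χ j n / (n : ℂ) ^ s

/-- `U` is the analytic continuation of `calU1R` to `Re s ≥ 9/10` (cf. `IsCalU1`). NOT PRINTED
(repair candidate of G-L4t3-1). [cite: Zhang2022LandauSiegel, §15 Lemma 15.3 p.87] -/
def IsCalU1R (j : ℕ) (U : ℂ → ℂ) : Prop :=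
  AnalyticOnNhd ℂ U {s : ℂ | 9 / 10 ≤ s.re} ∧ ∀ s : ℂ, 1 < s.re → U s = calU1R c' X χ j s

end RepairCandidates

/-- **Repair candidate of G-L4t3-1 — the value** (u053 for the repaired object): the continuation of
`calU1R` at `1` equals `φ(D)²D⁻²∏_{(q,D)=1}(1−q⁻²)²/(1−χ(q)q⁻²) + O(α₁)` (the printed value, now
claimed for `E`). NOT PRINTED. [cite: Zhang2022LandauSiegel, §15 Lemma 15.3 p.87] -/
def Step15_u053R : Prop :=
  ∃ C : ℝ, ForAllLarge fun D _ χ => AssumptionA D χ → ∀ j ∈ ({1, 2, 3} : Finset ℕ),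
    ∀ U : ℂ → ℂ, IsCalU1R c' X χ j U →
      ‖U 1 - (Nat.totient D : ℂ) ^ 2 / (D : ℂ) ^ 2 * eulerU1 χ‖ ≤ C * (alpha D * ell D)

/-- **Repair candidate of G-L4t3-1 — Lemma 15.3 for the repaired object**: `calU1R` has an analytic
continuation to `Re s ≥ 9/10` bounded by an absolute constant, and `Step15_u053R`. NOT PRINTED
("decl wanted" of row G-L4t3-1; the printed `Lemma153` part 1 is recorded there as not following).
[cite: Zhang2022LandauSiegel, §15 Lemma 15.3 p.87] -/
def Lemma153R : Prop :=
  (∃ C : ℝ, ForAllLarge fun D _ χ => AssumptionA D χ → ∀ j ∈ ({1, 2, 3} : Finset ℕ),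
      ∃ U : ℂ → ℂ, IsCalU1R c' X χ j U ∧ ∀ s : ℂ, 9 / 10 ≤ s.re → ‖U s‖ ≤ C) ∧
    Step15_u053R c' X

/-- **Repair candidate of G-L4t3-1 — u055 for the repaired object**:
`Σ_{n<T} χ(n)τ₂(n)ϖ₁ⱼ(n)/n = L′(1,χ)²E(1) + O(α₁)` with `E(1)` the value at `1` of the continuation of
`calU1R` (the residue at the triple pole `s = 0` of `ζ(1+s)²L(1+s−βⱼ,χ)²E(1+s)Tˢω₁(s)/s` is
`L′(1,χ)²E(1)(1 + O(α𝓛^{1.1}))` since `L(1−βⱼ,χ) = −βⱼL′(1,χ) + O(α²𝓛³)`). NOT PRINTED.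
[cite: Zhang2022LandauSiegel, §15 p.87] -/
def Step15_u055R : Prop :=
  ∃ C : ℝ, ForAllLarge fun D _ χ => AssumptionA D χ → ∀ j ∈ ({1, 2, 3} : Finset ℕ),
    ∀ U : ℂ → ℂ, IsCalU1R c' X χ j U →
      ‖sumLtT c' X χ j - deriv χ.LFunction 1 ^ 2 * U 1‖ ≤ C * (alpha D * ell D)

/-- **Repair candidate of G-L4t3-2**: u049 with `α log T = α𝓛^{1.1}` in place of `α₁ = α𝓛` (for a
prime `q < T`, `|1 − q^{βⱼ}| ≤ 3α log q ≤ 3α𝓛^{1.1}`). NOT PRINTED; implied by the printed u049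
(`step15_u049R_of_u049`). [cite: Zhang2022LandauSiegel, §15 p.87] -/
def Step15_u049R : Prop :=
  ∃ C : ℝ, ForAllLarge fun D _ χ => AssumptionA D χ → ∀ j ∈ ({1, 2, 3} : Finset ℕ),
    ∀ q : ℕ, q.Prime → D ^ 4 < q → (q : ℝ) < bigT D →
      ‖varrhoStar c' χ j q - X.varrho c' χ j q‖ ≤ C * ‖nu χ q‖ ∧
        ‖varrhoStar c' χ j q‖ ≤ C * (alpha D * ell D ^ (1.1 : ℝ) + ‖nu χ q‖)

/-- **Repair candidate of G-L4t3-3**: (15.23) with the error `O(1/𝓛)` that (15.22) (tex L4307)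
actually transmits (enough for (15.24)). NOT PRINTED; implied by the printed (15.23)
(`eq15_23R_of_eq15_23`). [cite: Zhang2022LandauSiegel, §15 (15.23) p.88] -/
def Eq15_23R : Prop :=
  ∃ C : ℝ, ForAllLarge fun D _ χ => AssumptionA D χ → ∀ j ∈ ({1, 2, 3} : Finset ℕ),
    ‖X.calS1 c' χ j - frake j * (frakA χ : ℂ) * (Nat.totient D : ℂ) / (D : ℂ)‖ ≤ C / ell D

/-- `𝓛 = log D ≥ 1` once `D ≥ 3` (`𝓛` of (2.1)). [cite: Zhang2022LandauSiegel, §2 (2.1)] -/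
theorem one_le_ell {D : ℕ} (hD : 3 ≤ D) : 1 ≤ ell D := by
  have h3 : (3 : ℝ) ≤ D := by exact_mod_cast hD
  rw [ell, Real.le_log_iff_exp_le (by linarith)]
  have := Real.exp_one_lt_d9
  linarith

/-- `α = π/𝓛⁹ ≥ 0`. [cite: Zhang2022LandauSiegel, §2 (2.10)] -/
theorem alpha_nonneg (D : ℕ) : 0 ≤ alpha D := by
  rw [alpha, bigP, Real.log_exp]
  exact div_nonneg Real.pi_pos.le (pow_nonneg (Real.log_natCast_nonneg D) 9)

/-- The printed u049 implies its repair candidate (`α𝓛 ≤ α𝓛^{1.1}` for `𝓛 ≥ 1`).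
[cite: Zhang2022LandauSiegel, §15 p.87] -/
theorem step15_u049R_of_u049 (h : Step15_u049 c' X) : Step15_u049R c' X := by
  obtain ⟨C, D₀, hC⟩ := h
  refine ⟨max C 0, max D₀ 3, fun D _ χ hD hq hp hA j hj q hqp hDq hqT => ?_⟩
  obtain ⟨h1, h2⟩ := hC D χ (le_trans (le_max_left _ _) hD) hq hp hA j hj q hqp hDq hqT
  have hℓ : 1 ≤ ell D := one_le_ell (le_trans (le_max_right _ _) hD)
  have hα : 0 ≤ alpha D := alpha_nonneg D
  have hpow : ell D ≤ ell D ^ (1.1 : ℝ) := by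
    calc ell D = ell D ^ (1 : ℝ) := (Real.rpow_one _).symm
      _ ≤ ell D ^ (1.1 : ℝ) := Real.rpow_le_rpow_of_exponent_le hℓ (by norm_num)
  have hC0 : C ≤ max C 0 := le_max_left _ _
  have hM0 : 0 ≤ max C 0 := le_max_right _ _
  refine ⟨le_trans h1 (mul_le_mul_of_nonneg_right hC0 (norm_nonneg _)), le_trans h2 ?_⟩
  have hsum : 0 ≤ alpha D * ell D + ‖nu χ q‖ :=
    add_nonneg (mul_nonneg hα (le_trans zero_le_one hℓ)) (norm_nonneg _)
  calc C * (alpha D * ell D + ‖nu χ q‖) ≤ max C 0 * (alpha D * ell D + ‖nu χ q‖) :=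
        mul_le_mul_of_nonneg_right hC0 hsum
    _ ≤ max C 0 * (alpha D * ell D ^ (1.1 : ℝ) + ‖nu χ q‖) := by
        gcongr

/-- The printed (15.23) implies its repair candidate (`C/𝓛³ ≤ max(C,0)/𝓛` for `𝓛 ≥ 1`).
[cite: Zhang2022LandauSiegel, §15 (15.23) p.88] -/
theorem eq15_23R_of_eq15_23 (h : Eq15_23 c' X) : Eq15_23R c' X := by
  obtain ⟨C, D₀, hC⟩ := h
  refine ⟨max C 0, max D₀ 3, fun D _ χ hD hq hp hA j hj => ?_⟩
  have h1 := hC D χ (le_trans (le_max_left _ _) hD) hq hp hA j hj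
  have hℓ : 1 ≤ ell D := one_le_ell (le_trans (le_max_right _ _) hD)
  have hℓ0 : 0 < ell D := lt_of_lt_of_le zero_lt_one hℓ
  refine le_trans h1 ?_
  calc C / ell D ^ 3 ≤ max C 0 / ell D ^ 3 :=
        div_le_div_of_nonneg_right (le_max_left _ _) (by positivity)
    _ ≤ max C 0 / ell D := by
        apply div_le_div_of_nonneg_left (le_max_right _ _) hℓ0
        calc ell D = ell D ^ 1 := (pow_one _).symm
          _ ≤ ell D ^ 3 := pow_le_pow_right₀ hℓ (by norm_num)

/-! ## Sharpened error terms for `ℛ₁*ℛ₁ⱼ` (cell RULING 9, GAP family G-d49-1; NOT printed)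

The printed `ℛ₁*ℛ₁ⱼ = cⱼ + O(1/𝓛)` (u060–u062) makes the step (15.17) + (15.23) ⇒ (15.24) require
`𝔞 = o(𝓛)`, which the manuscript does not state (it has `𝔞 ≫ 1`, Lemma 5.7; the tree has
`𝔞 ≤ 16e⁹𝓛⁴`, `Skeleton.frakA_le_ell_pow_four`). What the residue computation behind u058–u059
visibly yields is `O(𝓛⁻⁶)` (u058's `O(𝓛⁻²⁴)` against `|β₁β₂| ≍ α² = π²𝓛⁻¹⁸`, with `L′(1,χ) ≫ 1`), and
with it the step closes using only `𝔞 ≪ 𝓛⁴`. The `…S` variants below type this sharpened form for the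
discharge lane; each implies the printed node (`step15_u06k_of_u06kS`). -/

/-- `C/𝓛ⁿ ≤ max(C,0)/𝓛ᵐ` for `m ≤ n`, `𝓛 ≥ 1`. [folklore] -/
private theorem div_pow_le_max_div_pow {C ℓ : ℝ} (hℓ : 1 ≤ ℓ) {m n : ℕ} (hmn : m ≤ n) :
    C / ℓ ^ n ≤ max C 0 / ℓ ^ m := by
  have hℓ0 : 0 < ℓ := lt_of_lt_of_le zero_lt_one hℓ
  calc C / ℓ ^ n ≤ max C 0 / ℓ ^ n := div_le_div_of_nonneg_right (le_max_left _ _) (by positivity)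
    _ ≤ max C 0 / ℓ ^ m :=
        div_le_div_of_nonneg_left (le_max_right _ _) (by positivity) (pow_le_pow_right₀ hℓ hmn)

/-- **Sharpened u060** (RULING 9; NOT printed): `ℛ₁*ℛ₁₁ = 1 + O(𝓛⁻⁶)`.
[cite: Zhang2022LandauSiegel, §15 p.88] -/
def Step15_u060S : Prop :=
  ∃ C : ℝ, ForAllLarge fun D _ χ => AssumptionA D χ →
    ‖X.calR1star c' χ * X.calR1 c' χ 1 - 1‖ ≤ C / ell D ^ 6

/-- **Sharpened u061** (RULING 9; NOT printed): `ℛ₁*ℛ₁₂ = 2 + O(𝓛⁻⁶)`.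
[cite: Zhang2022LandauSiegel, §15 p.88] -/
def Step15_u061S : Prop :=
  ∃ C : ℝ, ForAllLarge fun D _ χ => AssumptionA D χ →
    ‖X.calR1star c' χ * X.calR1 c' χ 2 - 2‖ ≤ C / ell D ^ 6

/-- **Sharpened u062** (RULING 9; NOT printed): `ℛ₁*ℛ₁₃ = 1 + O(𝓛⁻⁶)`.
[cite: Zhang2022LandauSiegel, §15 p.88] -/
def Step15_u062S : Prop :=
  ∃ C : ℝ, ForAllLarge fun D _ χ => AssumptionA D χ →
    ‖X.calR1star c' χ * X.calR1 c' χ 3 - 1‖ ≤ C / ell D ^ 6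

/-- The sharpened u060 implies the printed u060. [cite: Zhang2022LandauSiegel, §15 p.88] -/
theorem step15_u060_of_u060S (h : Step15_u060S c' X) : Step15_u060 c' X := by
  obtain ⟨C, D₀, hC⟩ := h
  refine ⟨max C 0, max D₀ 3, fun D _ χ hD hq hp hA => ?_⟩
  have h1 := hC D χ (le_trans (le_max_left _ _) hD) hq hp hA
  have hℓ : 1 ≤ ell D := one_le_ell (le_trans (le_max_right _ _) hD)
  exact le_trans h1 (by simpa using div_pow_le_max_div_pow (C := C) hℓ (show 1 ≤ 6 by norm_num))

/-- The sharpened u061 implies the printed u061. [cite: Zhang2022LandauSiegel, §15 p.88] -/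
theorem step15_u061_of_u061S (h : Step15_u061S c' X) : Step15_u061 c' X := by
  obtain ⟨C, D₀, hC⟩ := h
  refine ⟨max C 0, max D₀ 3, fun D _ χ hD hq hp hA => ?_⟩
  have h1 := hC D χ (le_trans (le_max_left _ _) hD) hq hp hA
  have hℓ : 1 ≤ ell D := one_le_ell (le_trans (le_max_right _ _) hD)
  exact le_trans h1 (by simpa using div_pow_le_max_div_pow (C := C) hℓ (show 1 ≤ 6 by norm_num))

/-- The sharpened u062 implies the printed u062. [cite: Zhang2022LandauSiegel, §15 p.88] -/
theorem step15_u062_of_u062S (h : Step15_u062S c' X) : Step15_u062 c' X := by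
  obtain ⟨C, D₀, hC⟩ := h
  refine ⟨max C 0, max D₀ 3, fun D _ χ hD hq hp hA => ?_⟩
  have h1 := hC D χ (le_trans (le_max_left _ _) hD) hq hp hA
  have hℓ : 1 ≤ ell D := one_le_ell (le_trans (le_max_right _ _) hD)
  exact le_trans h1 (by simpa using div_pow_le_max_div_pow (C := C) hℓ (show 1 ≤ 6 by norm_num))

/-! ## MERGE (campaign protocol TODO-merge, resolved): `Inputs15AB` instantiated with the LANDED
§15A / §15B / Appendix-B objects of the sibling slices

The owners' definitions are CITED (imported), not restated: `𝓜₁ = Typed.Section15B.calM1` (the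
Euler-product continuation; its printed Dirichlet series is `Typed.Section15B.calM1Series`),
`ϖ₁ⱼ = Typed.Section15B.varpi1`, `𝒮₁ⱼ = Typed.Section15B.calS1`, `ℛ₁ⱼ = Typed.Section15B.calR1`
(file `TypedSection15B`, slice L4-t2), `ℛ₁* = Typed.Section15A.calR1star` (`TypedSection15A`, L4-t1),
`ϱⱼ = Typed.AppendixB.varrhoJ` (`TypedAppendixB`, L4-t10). Every parametric node `N c' X` above, read
at `X = inputs15AB`, is the manuscript's display about the manuscript's own objects; the `…I`
abbreviations below are the closed readings of the lemma-level nodes (for any other node `N`,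
the closed reading is the term `N c' inputs15AB`). -/

section Merge

/-- **The hypothesis structure, instantiated** with the landed sibling objects (see the section
docstring; binder order `c′, D, [NeZero D], χ, …` of the fields). [cite: Zhang2022LandauSiegel, §15 pp.83–86] -/
def inputs15AB : Inputs15AB where
  calM1 := fun c' _ _ χ => Typed.Section15B.calM1 c' χ
  varpi1 := fun c' _ _ χ => Typed.Section15B.varpi1 c' χ
  calS1 := fun c' D _ χ => Typed.Section15B.calS1 c' χ (Typed.Section15A.bLit D χ)
  calR1star := fun c' _ _ χ => Typed.Section15A.calR1star c' χ
  calR1 := fun c' _ _ χ => Typed.Section15B.calR1 c' χ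
  varrho := fun c' D _ _ => Typed.AppendixB.varrhoJ c' D

/-- The same instance with the χ-ABSORBED coefficient reading `b ↦ χ·b` of the cell's GAP row
G-L4t1-1 (`Typed.Section15A.bChi`) in `𝒮₁ⱼ`; all other fields as in `inputs15AB`. NOT the printed
reading. [cite: Zhang2022LandauSiegel, §15 (15.1) p.79] -/
def inputs15ABchi : Inputs15AB where
  calM1 := fun c' _ _ χ => Typed.Section15B.calM1 c' χ
  varpi1 := fun c' _ _ χ => Typed.Section15B.varpi1 c' χ
  calS1 := fun c' D _ χ => Typed.Section15B.calS1 c' χ (Typed.Section15A.bChi D χ)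
  calR1star := fun c' _ _ χ => Typed.Section15A.calR1star c' χ
  calR1 := fun c' _ _ χ => Typed.Section15B.calR1 c' χ
  varrho := fun c' D _ _ => Typed.AppendixB.varrhoJ c' D

variable (c' : ℝ)

/-- **Z22:(15.22)** about the landed objects (`Eq15_22` at `inputs15AB`). [cite: Zhang2022LandauSiegel, §15 (15.22) p.87] -/
abbrev Eq15_22I : Prop := Eq15_22 c' inputs15AB
/-- **Z22:Lem15.2** about the landed `𝓜₁` (`Lemma152` at `inputs15AB`) — the statement the discharge
lane proves from Appendix A (slice `TypedAppendixA2`). [cite: Zhang2022LandauSiegel, §15 Lemma 15.2 p.87] -/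
abbrev Lemma152I : Prop := Lemma152 c' inputs15AB
/-- **Z22:Lem15.3** AS PRINTED about the landed `ϖ₁ⱼ` (`Lemma153` at `inputs15AB`; GAP row G-L4t3-1).
[cite: Zhang2022LandauSiegel, §15 Lemma 15.3 p.87] -/
abbrev Lemma153I : Prop := Lemma153 c' inputs15AB
/-- Repair candidate G-L4t3-1 (Lemma 15.3 for `calU1R`) about the landed objects.
[cite: Zhang2022LandauSiegel, §15 Lemma 15.3 p.87] -/
abbrev Lemma153RI : Prop := Lemma153R c' inputs15AB
/-- **Z22:(15.23)** about the landed objects. [cite: Zhang2022LandauSiegel, §15 (15.23) p.88] -/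
abbrev Eq15_23I : Prop := Eq15_23 c' inputs15AB
/-- Repair candidate G-L4t3-3 ((15.23) with `O(1/𝓛)`) about the landed objects.
[cite: Zhang2022LandauSiegel, §15 (15.23) p.88] -/
abbrev Eq15_23RI : Prop := Eq15_23R c' inputs15AB

/-- The instantiated readings unfold to the owners' objects, e.g. `ϖ₁ⱼ`: by `rfl`.
[cite: Zhang2022LandauSiegel, §15 p.85] -/
theorem inputs15AB_varpi1 {D : ℕ} [NeZero D] (χ : DirichletCharacter ℂ D) (j n : ℕ) :
    inputs15AB.varpi1 c' χ j n = Typed.Section15B.varpi1 c' χ j n := rfl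

/-- `𝓜₁` field = `Typed.Section15B.calM1`, by `rfl`. [cite: Zhang2022LandauSiegel, §15 p.84] -/
theorem inputs15AB_calM1 {D : ℕ} [NeZero D] (χ : DirichletCharacter ℂ D) (d l : ℕ) (s : ℂ) :
    inputs15AB.calM1 c' χ d l s = Typed.Section15B.calM1 c' χ d l s := rfl

/-- `𝒮₁ⱼ` field = `Typed.Section15B.calS1` at the printed coefficients `bLit` (= `Skeleton.bcoef`),
by `rfl`. [cite: Zhang2022LandauSiegel, §15 p.85] -/
theorem inputs15AB_calS1 {D : ℕ} [NeZero D] (χ : DirichletCharacter ℂ D) (j : ℕ) :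
    inputs15AB.calS1 c' χ j = Typed.Section15B.calS1 c' χ (Typed.Section15A.bLit D χ) j := rfl

/-- `ϱⱼ` field = `Typed.AppendixB.varrhoJ`, by `rfl`. [cite: Zhang2022LandauSiegel, App. B p.106] -/
theorem inputs15AB_varrho {D : ℕ} [NeZero D] (χ : DirichletCharacter ℂ D) (j n : ℕ) :
    inputs15AB.varrho c' χ j n = Typed.AppendixB.varrhoJ c' D j n := rfl

end Merge

/-! ## Discharge of `Z22:§15.u049` in the reading of record `α₁ := α·log T` (`Step15_u049R`)

The display after (15.22) (§15 p.87, tex L4310–L4311): "for `D⁴ < q < T`,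
`ϱ*ⱼ(q) = ϱⱼ(q) + O(ν(q)) ≪ α₁ + ν(q)`". At a prime `q` everything is explicit:
`ϱ*ⱼ(q) = 1 + q^{βⱼ}χ(q)` ((15.21)), `ϱⱼ(q) = 1 − q^{βⱼ}` (App. B, `Typed.AppendixB.varrhoJ_prime_pow`),
`ν(q) = 1 + χ(q)`, and `βⱼ = i bⱼ` is purely imaginary ((2.13); `Typed.AppendixB.betaJ_bound`), so
`‖q^{βⱼ}‖ = 1` and `‖q^{βⱼ} − 1‖ ≤ |bⱼ| log q`. Hence `ϱ*ⱼ(q) − ϱⱼ(q) = q^{βⱼ}ν(q)` EXACTLY, and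
`‖ϱ*ⱼ(q)‖ ≤ ‖ν(q)‖ + |bⱼ| log q ≤ ‖ν(q)‖ + 3(1 + 5|c′|π)·α log T` for `q < T`. This proves the node
with `α₁ = α log T = α𝓛^{1.1}` (`Step15_u049R`, the cell's reading of record of the undefined `α₁`,
`Skeleton.alpha1`; SKEL-RULING 2026-08-26T00:26Z) for EVERY `D ≥ 3`, every character, every `j`,
with or without (A). The printed `α𝓛`-form `Step15_u049` is not claimed: at a prime `q` with
`χ(q) = −1` one has `‖ϱ*ⱼ(q)‖ = 2|sin(bⱼ log q / 2)| ≍ α log q`, which near `q = T` exceeds every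
fixed multiple of `α𝓛` (GAP row G-L4t3-2, class resolved-by-reading).

On the NOTE of the second cross-read (L4-t9, 2026-08-26T01:03:44Z) about the NOT-PRINTED repair
candidate `Step15_u055R`: its docstring's residue computation gives the error scale
`α log T·(1 + |L′(1,χ)|²)·|E(1)|`, not the `C·α𝓛` of its body; a discharge seat needing a kernel target
for u055 in the `E`-reading should state it with `Skeleton.alpha1 D * (1 + ‖deriv χ.LFunction 1‖ ^ 2)`
on the right (no further claim-variant is minted here; the printed `Step15_u055` is unchanged). -/

section UFortyNineDischarge

variable {D : ℕ} (χ : DirichletCharacter ℂ D)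

/-- `ν(q) = 1 + χ(q)` at a prime `q` (`ν = 1 ∗ χ`, §3 p.6). [cite: Zhang2022LandauSiegel, §3 p.6] -/
theorem nu_prime {q : ℕ} (hq : q.Prime) : nu χ q = 1 + χ (q : ZMod D) := by
  rw [nu, Literature.NumberTheory.LFunctions.divisorSumChar_apply, hq.divisors,
    Finset.sum_pair hq.one_lt.ne]
  simp

/-- `ϱ*ⱼ(q) = 1 + q^{βⱼ}χ(q)` at a prime `q` ((15.21): `ϱ*ⱼ(n) = Σ_{d∣n} d^{βⱼ}χ(d)`).
[cite: Zhang2022LandauSiegel, §15 (15.21) p.86] -/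
theorem varrhoStar_prime (c' : ℝ) (j : ℕ) {q : ℕ} (hq : q.Prime) :
    varrhoStar c' χ j q = 1 + (q : ℂ) ^ betaJ c' D j * χ (q : ZMod D) := by
  rw [varrhoStar, hq.divisors, Finset.sum_pair hq.one_lt.ne]
  simp

omit χ in
/-- `q^{βⱼ} = powI (−b) q` when `βⱼ = b·i` (`q ≥ 1`; `powI b n = n^{−ib}` of the tree's §7 majorant
file). [cite: Zhang2022LandauSiegel, §2 (2.13)] -/
theorem natCast_cpow_betaJ_eq_powI (c' : ℝ) (j : ℕ) {q : ℕ} (hq : 0 < q) {b : ℝ}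
    (hb : betaJ c' D j = (b : ℂ) * I) :
    (q : ℂ) ^ betaJ c' D j = MeanSquareMajorant.powI (-b) q := by
  rw [MeanSquareMajorant.powI_apply_of_ne_zero _ hq.ne', hb]
  push_cast
  ring_nf

omit χ in
/-- `α𝓛 ≤ π` for `D ≥ 3` (`α = π/𝓛⁹`, `𝓛 > 1`). [cite: Zhang2022LandauSiegel, §2 (2.10)] -/
theorem alpha_mul_ell_le_pi (hD : 3 ≤ D) : alpha D * ell D ≤ Real.pi := by
  have hℓ1 : 1 < ell D := one_lt_ell hD
  have hℓ : 0 ≤ ell D := by linarith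
  have hαdef : alpha D = Real.pi / ell D ^ 9 := by rw [alpha, bigP, Real.log_exp]
  rw [hαdef, div_mul_eq_mul_div, div_le_iff₀ (by positivity)]
  have h8 : (1 : ℝ) ≤ ell D ^ 8 := one_le_pow₀ hℓ1.le
  have h9 : ell D ≤ ell D ^ 9 := by
    calc ell D = ell D * 1 := (mul_one _).symm
      _ ≤ ell D * ell D ^ 8 := mul_le_mul_of_nonneg_left h8 hℓ
      _ = ell D ^ 9 := by ring
  exact mul_le_mul_of_nonneg_left h9 Real.pi_pos.le

omit χ in
/-- For `1 ≤ q < T = exp{𝓛^{1.1}}`: `log q ≤ 𝓛^{1.1}` (`= log T`). [cite: Zhang2022LandauSiegel, §6 p.12] -/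
theorem log_le_ell_rpow_of_lt_bigT {q : ℕ} (hq : 0 < q) (hqT : (q : ℝ) < bigT D) :
    Real.log q ≤ ell D ^ (1.1 : ℝ) := by
  have h := Real.log_le_log (by exact_mod_cast hq) hqT.le
  rwa [bigT, Real.log_exp] at h

/-- **The arithmetic of u049 at one prime**, for any `D ≥ 3`, any character `χ (mod D)`, any `j`,
any prime `q < T`, and any family `X` of §15A/B/App.-B objects whose `ϱⱼ` takes the Appendix-B value
`1 − q^{βⱼ}` at `q`: `‖ϱ*ⱼ(q) − ϱⱼ(q)‖ = ‖ν(q)‖ ≤ C‖ν(q)‖` and `‖ϱ*ⱼ(q)‖ ≤ C(α𝓛^{1.1} + ‖ν(q)‖)` with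
`C = 3(1 + 5|c′|π)`. [cite: Zhang2022LandauSiegel, §15 p.87] -/
theorem step15_u049R_at_prime (c' : ℝ) (X : Inputs15AB) [NeZero D] (hD : 3 ≤ D) (j : ℕ) {q : ℕ}
    (hq : q.Prime) (hqT : (q : ℝ) < bigT D)
    (hX : X.varrho c' χ j q = 1 - (q : ℂ) ^ betaJ c' D j) :
    ‖varrhoStar c' χ j q - X.varrho c' χ j q‖ ≤ 3 * (1 + 5 * |c'| * Real.pi) * ‖nu χ q‖ ∧
      ‖varrhoStar c' χ j q‖ ≤
        3 * (1 + 5 * |c'| * Real.pi) * (alpha D * ell D ^ (1.1 : ℝ) + ‖nu χ q‖) := by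
  have hℓ1 : 1 < ell D := one_lt_ell hD
  have hℓ : 0 ≤ ell D := by linarith
  have hα : 0 ≤ alpha D := alpha_nonneg D
  have hαℓ : alpha D * ell D ≤ Real.pi := alpha_mul_ell_le_pi hD
  have hq0 : 0 < q := hq.pos
  obtain ⟨b, hb, hbb⟩ := Typed.AppendixB.betaJ_bound c' D j hα hℓ
  have hpow := natCast_cpow_betaJ_eq_powI c' j hq0 hb
  have hstar := varrhoStar_prime χ c' j hq
  have hnu := nu_prime χ hq
  have hnorm1 : ‖MeanSquareMajorant.powI (-b) q‖ = 1 := MeanSquareMajorant.norm_powI_of_pos _ hq0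
  have hχ1 : ‖χ (q : ZMod D)‖ ≤ 1 := χ.norm_le_one _
  have hC3 : (3 : ℝ) ≤ 3 * (1 + 5 * |c'| * Real.pi) := by
    have : 0 ≤ 5 * |c'| * Real.pi := by positivity
    nlinarith
  constructor
  · -- `ϱ*ⱼ(q) − ϱⱼ(q) = q^{βⱼ}(1 + χ(q))`, of norm `‖ν(q)‖`
    have hdiff : varrhoStar c' χ j q - X.varrho c' χ j q =
        MeanSquareMajorant.powI (-b) q * nu χ q := by
      rw [hstar, hX, hnu, hpow]; ring
    rw [hdiff, norm_mul, hnorm1, one_mul]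
    have h0 : 0 ≤ ‖nu χ q‖ := norm_nonneg _
    nlinarith
  · -- `ϱ*ⱼ(q) = ν(q) + (q^{βⱼ} − 1)χ(q)`
    have hsplit : varrhoStar c' χ j q =
        nu χ q + (MeanSquareMajorant.powI (-b) q - 1) * χ (q : ZMod D) := by
      rw [hstar, hnu, hpow]; ring
    have hlog : Real.log q ≤ ell D ^ (1.1 : ℝ) := log_le_ell_rpow_of_lt_bigT hq0 hqT
    have hlog0 : 0 ≤ Real.log q := Real.log_nonneg (by exact_mod_cast hq.one_lt.le)
    have hb' : |b| ≤ 3 * (1 + 5 * |c'| * Real.pi) * alpha D := by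
      have habs : 0 ≤ |c'| := abs_nonneg _
      calc |b| ≤ 3 * alpha D * (1 + 5 * |c'| * alpha D * ell D) := hbb
        _ ≤ 3 * (1 + 5 * |c'| * Real.pi) * alpha D := by
            nlinarith [mul_le_mul_of_nonneg_left hαℓ (mul_nonneg habs hα)]
    have hpm1 : ‖MeanSquareMajorant.powI (-b) q - 1‖ ≤
        3 * (1 + 5 * |c'| * Real.pi) * (alpha D * ell D ^ (1.1 : ℝ)) := by
      calc ‖MeanSquareMajorant.powI (-b) q - 1‖ ≤ |(-b)| * Real.log q :=
            MeanSquareMajorant.norm_powI_sub_one_le (-b) hq0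
        _ = |b| * Real.log q := by rw [abs_neg]
        _ ≤ (3 * (1 + 5 * |c'| * Real.pi) * alpha D) * ell D ^ (1.1 : ℝ) :=
            mul_le_mul hb' hlog hlog0 (by positivity)
        _ = _ := by ring
    calc ‖varrhoStar c' χ j q‖
        = ‖nu χ q + (MeanSquareMajorant.powI (-b) q - 1) * χ (q : ZMod D)‖ := by rw [hsplit]
      _ ≤ ‖nu χ q‖ + ‖(MeanSquareMajorant.powI (-b) q - 1) * χ (q : ZMod D)‖ := norm_add_le _ _
      _ ≤ ‖nu χ q‖ + ‖MeanSquareMajorant.powI (-b) q - 1‖ := by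
          rw [norm_mul]
          have h0 : 0 ≤ ‖MeanSquareMajorant.powI (-b) q - 1‖ := norm_nonneg _
          nlinarith
      _ ≤ ‖nu χ q‖ + 3 * (1 + 5 * |c'| * Real.pi) * (alpha D * ell D ^ (1.1 : ℝ)) := by
          linarith
      _ ≤ 3 * (1 + 5 * |c'| * Real.pi) * (alpha D * ell D ^ (1.1 : ℝ) + ‖nu χ q‖) := by
          have h0 : 0 ≤ ‖nu χ q‖ := norm_nonneg _
          nlinarith

end UFortyNineDischarge

/-- **`Step15_u049R` for any input family whose `ϱⱼ` is the Appendix-B function at primes**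
(`ϱⱼ(q) = 1 − q^{βⱼ}`), with `C = 3(1 + 5|c′|π)` and `D₀ = 3`; the hypotheses "`χ` real primitive",
(A), `1 ≤ j ≤ 3`, `D⁴ < q` of the node are not used. [cite: Zhang2022LandauSiegel, §15 p.87] -/
theorem step15_u049R_of_varrho_prime (c' : ℝ) (X : Inputs15AB)
    (hX : ∀ {D : ℕ} [NeZero D] (χ : DirichletCharacter ℂ D) (j q : ℕ), q.Prime →
      X.varrho c' χ j q = 1 - (q : ℂ) ^ betaJ c' D j) :
    Step15_u049R c' X :=
  ⟨3 * (1 + 5 * |c'| * Real.pi), 3, fun _ _ χ hD _ _ _ j _ _ hq _ hqT =>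
    step15_u049R_at_prime χ c' X hD j hq hqT (hX χ j _ hq)⟩

/-- **Z22:§15.u049 DISCHARGED in the reading of record `α₁ := α·log T`**: `Step15_u049R` holds for
the manuscript's own objects (`inputs15AB`: `ϱⱼ = Typed.AppendixB.varrhoJ`), for every `c′`.
Kernel-checked; see the section docstring for the one-prime arithmetic and for why the printed
`α𝓛`-form `Step15_u049` is not claimed (G-L4t3-2). [cite: Zhang2022LandauSiegel, §15 p.87] -/
theorem step15_u049R_holds (c' : ℝ) : Step15_u049R c' inputs15AB :=
  step15_u049R_of_varrho_prime c' inputs15AB fun {D} _ _ j q hq => by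
    have h1 := Typed.AppendixB.varrhoJ_prime_pow c' D j hq (le_refl 1)
    rw [pow_one] at h1
    exact h1

/-- The same for the χ-absorbed coefficient instance `inputs15ABchi` (its `ϱⱼ` field is the same
function). [cite: Zhang2022LandauSiegel, §15 p.87] -/
theorem step15_u049R_chi_holds (c' : ℝ) : Step15_u049R c' inputs15ABchi :=
  step15_u049R_of_varrho_prime c' inputs15ABchi fun {D} _ _ j q hq => by
    have h1 := Typed.AppendixB.varrhoJ_prime_pow c' D j hq (le_refl 1)
    rw [pow_one] at h1
    exact h1

/-- **u049 with the banked object `α₁ = Skeleton.alpha1`** (`= α·log T`; no new claim is minted —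
this is `step15_u049R_holds` rewritten along `Skeleton.log_bigT`): for all large `D`, under (A),
`1 ≤ j ≤ 3`, primes `D⁴ < q < T`: `‖ϱ*ⱼ(q) − ϱⱼ(q)‖ ≤ C‖ν(q)‖` and `‖ϱ*ⱼ(q)‖ ≤ C(α₁ + ‖ν(q)‖)`.
[cite: Zhang2022LandauSiegel, §15 p.87] -/
theorem step15_u049_alpha1 (c' : ℝ) :
    ∃ C : ℝ, ForAllLarge fun D _ χ => AssumptionA D χ → ∀ j ∈ ({1, 2, 3} : Finset ℕ),
      ∀ q : ℕ, q.Prime → D ^ 4 < q → (q : ℝ) < bigT D →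
        ‖varrhoStar c' χ j q - Typed.AppendixB.varrhoJ c' D j q‖ ≤ C * ‖nu χ q‖ ∧
          ‖varrhoStar c' χ j q‖ ≤ C * (alpha1 D + ‖nu χ q‖) := by
  obtain ⟨C, D₀, h⟩ := step15_u049R_holds c'
  refine ⟨C, D₀, fun D _ χ hD hq hp hA j hj q hqp hDq hqT => ?_⟩
  have h1 := h D χ hD hq hp hA j hj q hqp hDq hqT
  rw [alpha1, log_bigT]
  exact h1

/-! ## `Z22:§15.u054`: the Mellin step is an exact identity

The display "By (4.2) and (4.3)" (§15 p.87, tex L4354–L4357) chains two relations: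
`Σ_{n<T} χ(n)τ₂(n)ϖ₁ⱼ(n)/n = Σₙ χ(n)τ₂(n)ϖ₁ⱼ(n)n⁻¹g(T/n) + O(α₁)` (unsmoothing, (4.2)) and
`Σₙ χ(n)τ₂(n)ϖ₁ⱼ(n)n⁻¹g(T/n) = (2πi)⁻¹∫_{(1)} ζ(1+s)²L(1+s,χ)²𝒰₁ⱼ(1+s)Tˢω₁(s)ds/s` ((4.3), Mellin
inversion). The second is an EXACT identity as soon as the Dirichlet series
`Σₙ χ(n)τ₂(n)ϖ₁ⱼ(n)n^{−s}` converges absolutely at `σ = 2` (the line `Re(1+s) = 2` of the integral):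
on that line `ζ(1+s)L(1+s,χ) ≠ 0`, so the integrand is the series times the kernel
`Tˢω₁(s)/s`, and the interchange of `Σ` and `∫` is the tree's `GaussWeight.integral_LSeries_mul_kernel`
(§4, (4.1)/(4.3): `(2πi)⁻¹∫_{(c)} yʷω₁(w)dw/w = g(y)`). Hence `Step15_u054` follows from its first
relation alone plus that absolute convergence (`step15_u054_of`); no `O(α₁)` is lost at the second
step. -/

section UFiftyFourMellin

variable (c' : ℝ) (X : Inputs15AB) {D : ℕ} [NeZero D] (χ : DirichletCharacter ℂ D)

/-- The coefficients `χ(n)τ₂(n)ϖ₁ⱼ(n)` of the series in `𝒰₁ⱼ` (u052) and of the sums of u054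
(plumbing abbreviation). [cite: Zhang2022LandauSiegel, §15 Lemma 15.3 p.87] -/
def coeffU (j : ℕ) : ℕ → ℂ := fun n => χ (n : ZMod D) * (n.divisors.card : ℂ) * X.varpi1 c' χ j n

/-- The `tsum` in `calU1` is the `L`-series of `coeffU` (the `n = 0` term vanishes on both sides:
`τ₂(0) = 0`). [cite: Zhang2022LandauSiegel, §15 Lemma 15.3 p.87] -/
theorem tsum_coeff_div_cpow_eq_LSeries (j : ℕ) (s : ℂ) :
    ∑' n : ℕ, χ (n : ZMod D) * (n.divisors.card : ℂ) * X.varpi1 c' χ j n / (n : ℂ) ^ s =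
      LSeries (coeffU c' X χ j) s := by
  refine tsum_congr fun n => ?_
  rcases eq_or_ne n 0 with rfl | hn
  · simp [LSeries.term_zero]
  · rw [LSeries.term_of_ne_zero hn]; rfl

/-- On the line `Re s = 1` the integrand of u054 is the series `Σₙ χ(n)τ₂(n)ϖ₁ⱼ(n)n^{−(1+s)}` times
the §4 kernel `Tˢω₁(s)/s` (`ζ(1+s)L(1+s,χ) ≠ 0` there, Mathlib
`riemannZeta_ne_zero_of_one_le_re`, `DirichletCharacter.LFunction_ne_zero_of_one_le_re`).
[cite: Zhang2022LandauSiegel, §15 p.87] -/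
theorem mellinIntegrand_line (j : ℕ) (t : ℝ) :
    mellinIntegrand c' X χ j (1 + t * I) =
      LSeries (coeffU c' X χ j) (1 + ((1 : ℝ) + t * I)) * GaussWeight.kernel (ell D ^ 30) 1 (bigT D) t := by
  have hre : (1 + (1 + (t : ℂ) * I)).re = 2 := by simp; norm_num
  have hζ : riemannZeta (1 + (1 + t * I)) ≠ 0 :=
    riemannZeta_ne_zero_of_one_le_re (by rw [hre]; norm_num)
  have hL : χ.LFunction (1 + (1 + t * I)) ≠ 0 :=
    DirichletCharacter.LFunction_ne_zero_of_one_le_re χ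
      (Or.inr (by intro h; have := congrArg Complex.re h; rw [hre] at this; norm_num at this))
      (by rw [hre]; norm_num)
  have hZ : riemannZeta (1 + (1 + t * I)) ^ 2 * χ.LFunction (1 + (1 + t * I)) ^ 2 ≠ 0 :=
    mul_ne_zero (pow_ne_zero _ hζ) (pow_ne_zero _ hL)
  rw [mellinIntegrand, calU1, tsum_coeff_div_cpow_eq_LSeries, GaussWeight.kernel]
  push_cast
  field_simp

omit [NeZero D] in
/-- `Λ = 𝓛³⁰ > 0` once `D ≥ 2`. [cite: Zhang2022LandauSiegel, §4 p.17] -/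
theorem ell_pow_thirty_pos (hD : 2 ≤ D) : 0 < ell D ^ 30 := by
  have : 0 < ell D := Real.log_pos (by exact_mod_cast hD)
  positivity

/-- **The second relation of `Z22:§15.u054` is an exact identity**: if
`Σₙ |χ(n)τ₂(n)ϖ₁ⱼ(n)| n⁻² < ∞`, then
`Σₙ χ(n)τ₂(n)ϖ₁ⱼ(n)n⁻¹g(T/n) = (2πi)⁻¹∫_{(1)} ζ(1+s)²L(1+s,χ)²𝒰₁ⱼ(1+s)Tˢω₁(s)ds/s` (`D ≥ 2`).
[cite: Zhang2022LandauSiegel, §15 p.87] -/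
theorem sumWeighted_eq_mellinIntegral (hD : 2 ≤ D) (j : ℕ)
    (hs : LSeriesSummable (coeffU c' X χ j) 2) :
    sumWeighted c' X χ j = mellinIntegral c' X χ j := by
  have hΛ := ell_pow_thirty_pos hD
  have hT : 0 < bigT D := Real.exp_pos _
  have hs' : LSeriesSummable (coeffU c' X χ j) ((1 : ℂ) + ((1 : ℝ) : ℂ)) := by
    convert hs using 2; push_cast; norm_num
  have key := GaussWeight.integral_LSeries_mul_kernel hΛ one_pos hT hs'
  -- the right side of `key` is `sumWeighted`
  have hR : (∑' n : ℕ, LSeries.term (coeffU c' X χ j) 1 n *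
      (GaussWeight.gWeight (ell D ^ 30) (bigT D / n) : ℂ)) = sumWeighted c' X χ j := by
    rw [sumWeighted]
    refine tsum_congr fun n => ?_
    rcases eq_or_ne n 0 with rfl | hn
    · simp [LSeries.term_zero]
    · rw [LSeries.term_of_ne_zero hn, Complex.cpow_one, gW]; rfl
  -- the left side of `key` is `mellinIntegral`
  have hL : (1 / (2 * π) : ℂ) * ∫ t : ℝ, LSeries (coeffU c' X χ j) (1 + ((1 : ℝ) + t * I)) *
      GaussWeight.kernel (ell D ^ 30) 1 (bigT D) t = mellinIntegral c' X χ j := by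
    rw [mellinIntegral]
    simp_rw [mellinIntegrand_line]
    push_cast
    rfl
  rw [← hR, ← hL, key]

end UFiftyFourMellin

/-- **`Z22:§15.u054` ⇐ its first relation + absolute convergence at `σ = 2`**: the node's second
bound is the first one verbatim, because the Mellin step is exact (`sumWeighted_eq_mellinIntegral`).
The two hypotheses are stated inline (the unsmoothing relation "`Σ_{n<T} = Σₙ … g(T/n) + O(α₁)`" of
(4.2), and `Σₙ|χ(n)τ₂(n)ϖ₁ⱼ(n)|n⁻² < ∞`); no new claim is minted. [cite: Zhang2022LandauSiegel, §15 p.87] -/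
theorem step15_u054_of (c' : ℝ) (X : Inputs15AB)
    (h1 : ∃ C : ℝ, ForAllLarge fun D _ χ => AssumptionA D χ → ∀ j ∈ ({1, 2, 3} : Finset ℕ),
      ‖sumLtT c' X χ j - sumWeighted c' X χ j‖ ≤ C * (alpha D * ell D))
    (h2 : ForAllLarge fun D _ χ => AssumptionA D χ → ∀ j ∈ ({1, 2, 3} : Finset ℕ),
      LSeriesSummable (coeffU c' X χ j) 2) :
    Step15_u054 c' X := by
  obtain ⟨C, D₁, h1⟩ := h1
  obtain ⟨D₂, h2⟩ := h2
  refine ⟨C, max (max D₁ D₂) 2, fun D _ χ hD hq hp hA j hj => ?_⟩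
  have hD₁ : D₁ ≤ D := le_trans (le_trans (le_max_left _ _) (le_max_left _ _)) hD
  have hD₂ : D₂ ≤ D := le_trans (le_trans (le_max_right _ _) (le_max_left _ _)) hD
  have hD2 : 2 ≤ D := le_trans (le_max_right _ _) hD
  have hb := h1 D χ hD₁ hq hp hA j hj
  refine ⟨hb, ?_⟩
  rw [← sumWeighted_eq_mellinIntegral c' X χ hD2 j (h2 D χ hD₂ hq hp hA j hj)]
  exact hb

/-! ## Lemma 15.3 part 1, reading of record: a `D`-dependent bound (cell RULING 15e; NOT printed)

Cell RULING 15e (STATUS 2026-08-26T01:35:30Z, on L4-t9's note 01:34:11Z): at a prime `q ∣ D` the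
Euler factor of `𝒰₁ⱼ` is exactly `(1 − q^{−s})²` (`χ(q) = 0`; the printed and the repaired
normalisers coincide there), so on `Re s ≥ 9/10` the supremum of the continuation reaches
`∏_{q∣D}(1 + q^{−9/10})²` — bounded for each `D`, NOT uniformly in `D` without an input on the small
prime factors of an (A)-modulus that is nowhere in print. The printed word is "bounded" (Lemma 15.3,
p.87), which the per-`D` reading satisfies, and the only consumer (u055: the contour shift to
`Re s = 9/10` against `T^{−1/10} = exp(−𝓛^{1.1}/10)`) tolerates any bound `≤ C·exp(2𝓛^{1/10})`. Hence
the DISCHARGE TARGET OF RECORD for Lemma 15.3 part 1 is the primed repair candidate `Lemma153Rp`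
below (over the repaired normaliser `calU1R` of G-L4t3-1, with the value clause `Step15_u053R`); the
uniform `Lemma153R` and the printed `Lemma153` stay typed as the stronger readings
(`lemma153Rp_of_R : Lemma153R → Lemma153Rp`). Its Appendix-A deduction twin is
`Typed.AppendixA2.Lem153_pfR` (slice L4-t9). -/

/-- **Lemma 15.3 for the repaired object, `D`-dependent bound — the discharge target of record for
part 1** (cell RULING 15e; NOT PRINTED, a reading of the printed "bounded"): `calU1R` has an analytic
continuation `U` to `Re s ≥ 9/10` with `‖U(s)‖ ≤ C·exp(2𝓛^{1/10})` there (`𝓛 = log D`; the constant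
`C` absolute, the bound `D`-dependent), and `Step15_u053R` (the value at `1`). Weaker than `Lemma153R`
(uniform bound). [cite: Zhang2022LandauSiegel, §15 Lemma 15.3 p.87] -/
def Lemma153Rp : Prop :=
  (∃ C : ℝ, ForAllLarge fun D _ χ => AssumptionA D χ → ∀ j ∈ ({1, 2, 3} : Finset ℕ),
      ∃ U : ℂ → ℂ, IsCalU1R c' X χ j U ∧
        ∀ s : ℂ, 9 / 10 ≤ s.re → ‖U s‖ ≤ C * Real.exp (2 * ell D ^ (1 / 10 : ℝ))) ∧
    Step15_u053R c' X

/-- The uniform repair candidate implies the primed one (`C ≤ max(C,0)·exp(2𝓛^{1/10})`, as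
`exp ≥ 1`). [cite: Zhang2022LandauSiegel, §15 Lemma 15.3 p.87] -/
theorem lemma153Rp_of_R (h : Lemma153R c' X) : Lemma153Rp c' X := by
  obtain ⟨⟨C, D₀, hC⟩, h53⟩ := h
  refine ⟨⟨max C 0, D₀, fun D _ χ hD hq hp hA j hj => ?_⟩, h53⟩
  obtain ⟨U, hU, hb⟩ := hC D χ hD hq hp hA j hj
  refine ⟨U, hU, fun s hs => le_trans (hb s hs) ?_⟩
  have h1 : (1 : ℝ) ≤ Real.exp (2 * ell D ^ (1 / 10 : ℝ)) :=
    Real.one_le_exp (by have := Real.rpow_nonneg (Real.log_natCast_nonneg D) (1 / 10 : ℝ);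
                        rw [ell]; positivity)
  calc C ≤ max C 0 := le_max_left _ _
    _ = max C 0 * 1 := (mul_one _).symm
    _ ≤ max C 0 * Real.exp (2 * ell D ^ (1 / 10 : ℝ)) :=
        mul_le_mul_of_nonneg_left h1 (le_max_right _ _)

section MergeRp

variable (c' : ℝ)

/-- **The discharge target of record for Lemma 15.3 about the landed objects** (`Lemma153Rp` at
`inputs15AB`; cell RULING 15e) — the conclusion of `Typed.AppendixA2.Lem153_pfR`.
[cite: Zhang2022LandauSiegel, §15 Lemma 15.3 p.87] -/
abbrev Lemma153RpI : Prop := Lemma153Rp c' inputs15AB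

/-- `Lemma153RI c′ → Lemma153RpI c′`. [cite: Zhang2022LandauSiegel, §15 Lemma 15.3 p.87] -/
theorem lemma153RpI_of_RI (h : Lemma153RI c') : Lemma153RpI c' := lemma153Rp_of_R c' inputs15AB h

end MergeRp

end Literature.NumberTheory.LFunctions.Zhang2022.Typed.Section15C
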